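import Literature.MathematicalPhysics.KineticTheory.Georgii1995HardSphereCanonicalLocalLimit
import Literature.MathematicalPhysics.KineticTheory.ContactLangevinMaxwellianInvariance
import Literature.MathematicalPhysics.StatisticalMechanics.HardSphereConditionalEquilibrium
import Literature.MathematicalPhysics.StatisticalMechanics.SpecificRelativeEntropy
import Literature.Analysis.FunctionSpaces.PoissonMeckePrelims
import Mathlib.MeasureTheory.Measure.GiryMonad
import HarnessLib

/-!
# The hard-sphere DLR specification as a kernel and the GNZ activity–density sandwich (general dimension)

Topic `Literature/MathematicalPhysics/KineticTheory`; PROOFS ONLY (no named facts), in the vocabulary of the tree's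
DLR class `Literature.Analysis.FluidPDE.IsHardSphereGibbs ε z β u` (finite-volume specification `gibbsSpec`,
un-normalised weight `gibbsWeight`, superposition `superposeIn`, window hard core `HardCoreIn`, one-particle a-priori
law `maxwellPhaseMeasure`, all of `Literature/Analysis/FluidPDE/InfiniteHardSphereFlow.lean`), for the gas of hard
spheres of ANY diameter `ε` in `ℝ^d`, ANY finite dimension.  First instalment of the bottom-up work towards the named
fact `Literature.MathematicalPhysics.KineticTheory.HardSphereGibbsLowDensityUniqueness`
(`Georgii1995HardSphereCanonicalLocalLimit.lean`): it supplies the published ingredient "small density forces small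
activity" in the elementary GNZ form, with no thermodynamics.

* Measurability (Richthammer 2007 §3.6/§4.4, in phase space): the hard-core event `{X | HardCoreIn ε Λ X}` is
  measurable (`measurableSet_hardCoreIn`), the superposition `(x, Y) ↦ superposeIn Λ x Y` is jointly measurable
  (`measurable_superposeIn`), the weight and the specification are measurable in the boundary condition
  (`measurable_gibbsWeight`, `measurable_gibbsSpec`).
* The specification as a MEASURE (`gibbsWeightMeasure`, `gibbsSpecMeasure`, `…_apply`), a measurable kernel
  (`measurable_gibbsSpecMeasure`), `1 ≤ gibbsWeight … univ`; the DLR equation for functions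
  `∫⁻ F ∂μ = ∫⁻ Y, ∫⁻ F ∂γ_Λ(·|Y) ∂μ` (`IsHardSphereGibbs` ⇒ `μ.bind γ_Λ = μ`, `lintegral_eq_lintegral_gibbsSpecMeasure`),
  and `γ_Λ(·|Y)` is a probability measure for `μ`-a.e. `Y` (`ae_gibbsWeight_univ_ne_top`).
* The one-particle law: `maxwellPhaseMeasure β u Λ = Leb|_Λ ⊗ (M_β(v-u) dv)` with a PROBABILITY velocity factor for
  `β > 0` (`isProbabilityMeasure_maxwellVelocity`), so `m(univ) = vol Λ`, `m` has no atoms, and `m^{⊗k}`-a.s. the thrown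
  points are distinct with positions in `Λ`.
* Ruelle's bound `ρ_Λ ≤ z` in DLR form: `E_μ[#(particles above Λ)] ≤ z · vol Λ` (`lintegral_count_le_activity_mul_volume`;
  Ruelle 1969 (2.5)); the GNZ insertion inequality (the first-order consequence of the Georgii–Nguyen–Zessin equation,
  Dereudre 2019 Thm 2, used exactly as in the proof of his Prop. 10):
  `z · vol Λ ≤ E_μ[#Λ] + z ∫_Λ E_μ[#B(q, ε)] dq` (`activity_mul_volume_le_of_isHardSphereGibbs`).  The proof here is
  self-contained (insertion/deletion of one thrown particle under the DLR equation), it does not use the GNZ equation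
  as such.
* Translation invariance: every translated unit cube carries the density; a ball `B(q, ε)` with `2ε ≤ n` is covered by
  `n^d` translated unit cubes, so `E_μ[#B(q, ε)] ≤ n^d ρ`; hence the SANDWICH `z (1 - n^d ρ) ≤ ρ ≤ z`
  (`activity_density_sandwich`; Dereudre 2019 Prop. 10 prints `z/(1 + z v_d R^d) ≤ E N_{[0,1]^d} ≤ z` for the
  stationary hard-core gas, with the volume `v_d R^d` of the exclusion ball where we use the cruder cube count `n^d`)
  and the dilute-gas activity bound `n^d ρ ≤ 1/2 ⇒ z ≤ 2ρ` (`activity_le_two_mul_density`), so that two such states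
  of the same small density have `|z - z'| ≤ ρ` (`abs_activity_sub_le_density`).

The `d = 3`, `ε ≤ 1` versions of these statements were first proved on the summit side
(`Summits/AtomisticToContinuum/HydrodynamicLimit/Theorems/AntiMazurCoboundariesCorrectorPressureDecayKifer*.lean`);
this file is their dimension-free Literature form.  Nothing here is specific to `d = 3`.

## References

* D. Ruelle, *Statistical Mechanics: Rigorous Results* (1969), §4.2 (2.5), Thm 4.2.3 (held: PDF pp. 66–71).
* D. Dereudre, *Introduction to the theory of Gibbs point processes*, in: Stochastic Geometry, LNM 2237 (2019)
  181–229 (arXiv:1701.08105, held), §2.5 Thm 2 (GNZ equations) and Prop. 10 (`z/(1+z v_d R^d) ≤ E N_{[0,1]^d} ≤ z`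
  for the hard-core gas). [Dereudre2019]
* X. X. Nguyen, H. Zessin, *Integral and differential characterizations of the Gibbs process*, Math. Nachr. 88
  (1979) 105–115 (the original GNZ equation; not held). [NguyenZessin1979]
* T. Richthammer, *Translation-invariance of two-dimensional Gibbsian point processes*, Comm. Math. Phys. 274
  (2007), §3.2–3.6, §4.4 (measurability of hard-core specifications).
-/

noncomputable section

open MeasureTheory ProbabilityTheory Set Filter Topology Function
open scoped ENNReal

namespace Literature.MathematicalPhysics.KineticTheory

namespace HardSphereDLR

open Literature.Analysis.FluidPDE (IsHardSphereGibbs IsTranslationInvariant HardCoreIn superposeIn gibbsWeight gibbsSpec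
  maxwellPhaseMeasure localMaxwellian)
open Literature.Analysis.FunctionSpaces (PointConfig maxwellianBeta)

variable {d : Type*} [Fintype d]

local notation "𝔼" => EuclideanSpace ℝ d

/-! ## Measurability of the hard core and of the superposition -/

section HardCoreMeasurability

/-- Negation of the hard-core constraint in the window `Λ`: some particle with position in `Λ` has another particle
at position-distance `< ε`. [folklore] -/
theorem not_hardCoreIn_iff (ε : ℝ) (Λ : Set 𝔼) (X : PointConfig (𝔼 × 𝔼)) :
    ¬ HardCoreIn ε Λ X ↔ ∃ p ∈ X, p.1 ∈ Λ ∧ ∃ q ∈ X, q ≠ p ∧ ‖p.1 - q.1‖ < ε := by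
  constructor
  · intro h
    simp only [HardCoreIn, not_forall, not_le, exists_prop] at h
    obtain ⟨p, hp, q, hq, hpq, hΛ, hd⟩ := h
    rcases hΛ with hpΛ | hqΛ
    · exact ⟨p, hp, hpΛ, q, hq, Ne.symm hpq, hd⟩
    · exact ⟨q, hq, hqΛ, p, hp, hpq, by rwa [norm_sub_rev]⟩
  · rintro ⟨p, hp, hpΛ, q, hq, hqp, hd⟩ h
    exact absurd (h p hp q hq (Ne.symm hqp) (Or.inl hpΛ)) (not_le.2 hd)

omit [Fintype d] in
/-- `N_s(X) ≥ 2` iff `X` has two distinct points in `s`. [folklore] -/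
theorem two_le_count_iff (X : PointConfig (𝔼 × 𝔼)) (s : Set (𝔼 × 𝔼)) :
    2 ≤ X.count s ↔ ∃ a ∈ X, ∃ b ∈ X, a ∈ s ∧ b ∈ s ∧ a ≠ b := by
  rw [PointConfig.count, ← (one_add_one_eq_two : (1 : ℕ∞) + 1 = 2), ENat.add_one_le_iff ENat.one_ne_top,
    Set.one_lt_encard_iff]
  simp only [mem_inter_iff, PointConfig.mem_carrier]
  constructor
  · rintro ⟨a, b, ⟨ha, has⟩, ⟨hb, hbs⟩, hab⟩
    exact ⟨a, ha, b, hb, has, hbs, hab⟩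
  · rintro ⟨a, ha, b, hb, has, hbs, hab⟩
    exact ⟨a, b, ⟨ha, has⟩, ⟨hb, hbs⟩, hab⟩

/-- **The hard-core event `{X | HardCoreIn ε Λ X}` is measurable** for measurable `Λ` (count σ-algebra): its complement
is `{X | ∑_{p ∈ X} 1_Λ(p.1) 1{N_{B(p)}(X) ≥ 2} ≠ 0}`, `B(p) = {q | ‖p.1 − q.1‖ < ε}`, a Campbell sum of occupation
events (Richthammer 2007 §4.4, in phase space). [cite: Richthammer2007, §4.4] -/
theorem measurableSet_hardCoreIn (ε : ℝ) {Λ : Set 𝔼} (hΛ : MeasurableSet Λ) :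
    MeasurableSet {X : PointConfig (𝔼 × 𝔼) | HardCoreIn ε Λ X} := by
  set B : Set ((PointConfig (𝔼 × 𝔼) × (𝔼 × 𝔼)) × (𝔼 × 𝔼)) := {r | ‖r.1.2.1 - r.2.1‖ < ε} with hB
  have hball : MeasurableSet B :=
    measurableSet_lt ((measurable_snd.comp measurable_fst).fst.sub measurable_snd.fst).norm measurable_const
  have hF : Measurable fun a : PointConfig (𝔼 × 𝔼) × (𝔼 × 𝔼) => a.1.toMeasure (Prod.mk a ⁻¹' B) :=
    PointConfig.measurable_toMeasure_preimage hball measurable_fst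
  set S : Set (PointConfig (𝔼 × 𝔼) × (𝔼 × 𝔼)) := {a | a.2.1 ∈ Λ ∧ 2 ≤ a.1.toMeasure (Prod.mk a ⁻¹' B)} with hS
  have hSm : MeasurableSet S := (hΛ.preimage measurable_snd.fst).inter (measurableSet_le measurable_const hF)
  have hT : Measurable fun X : PointConfig (𝔼 × 𝔼) =>
      ∑' p : ((X : PointConfig (𝔼 × 𝔼)) : Set (𝔼 × 𝔼)), S.indicator 1 (X, (p : 𝔼 × 𝔼)) :=
    PointConfig.measurable_tsum_carrier (measurable_one.indicator hSm) measurable_id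
  have hcount : ∀ (X : PointConfig (𝔼 × 𝔼)) (p : 𝔼 × 𝔼),
      X.toMeasure (Prod.mk (X, p) ⁻¹' B) = X.count {q | ‖p.1 - q.1‖ < ε} := fun X p => by
    rw [PointConfig.toMeasure_apply _ (measurable_prodMk_left hball)]
    rfl
  have hmemS : ∀ (X : PointConfig (𝔼 × 𝔼)) (p : 𝔼 × 𝔼), p ∈ X →
      ((X, p) ∈ S ↔ p.1 ∈ Λ ∧ ∃ q ∈ X, q ≠ p ∧ ‖p.1 - q.1‖ < ε) := fun X p hp => by
    rw [hS, mem_setOf_eq, hcount]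
    refine and_congr Iff.rfl ?_
    have hcast : (2 : ℝ≥0∞) ≤ (X.count {q | ‖p.1 - q.1‖ < ε} : ℝ≥0∞) ↔ 2 ≤ X.count {q | ‖p.1 - q.1‖ < ε} := by
      norm_cast
    rw [hcast, two_le_count_iff]
    constructor
    · rintro ⟨a, ha, b, hb, had, hbd, hab⟩
      simp only [mem_setOf_eq] at had hbd
      by_cases hap : a = p
      · subst hap
        exact ⟨b, hb, Ne.symm hab, hbd⟩
      · exact ⟨a, ha, hap, had⟩
    · rintro ⟨q, hq, hqp, hd⟩
      by_cases hε : 0 < ε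
      · exact ⟨p, hp, q, hq, by simp [hε], hd, hqp.symm⟩
      · exact absurd ((norm_nonneg _).trans_lt hd) hε
  have key : {X : PointConfig (𝔼 × 𝔼) | HardCoreIn ε Λ X} =
      {X | ∑' p : ((X : PointConfig (𝔼 × 𝔼)) : Set (𝔼 × 𝔼)),
        S.indicator (1 : PointConfig (𝔼 × 𝔼) × (𝔼 × 𝔼) → ℝ≥0∞) (X, (p : 𝔼 × 𝔼)) = 0} := by
    ext X
    simp only [mem_setOf_eq, ENNReal.tsum_eq_zero, Set.indicator_apply_eq_zero, Pi.one_apply, one_ne_zero,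
      imp_false, Subtype.forall]
    rw [← not_iff_not, not_hardCoreIn_iff]
    push Not
    constructor
    · rintro ⟨p, hp, hpΛ, q, hq, hqp, hd⟩
      exact ⟨p, hp, (hmemS X p hp).2 ⟨hpΛ, q, hq, hqp, hd⟩⟩
    · rintro ⟨p, hp, hpS⟩
      obtain ⟨hpΛ, q, hq, hqp, hd⟩ := (hmemS X p hp).1 hpS
      exact ⟨p, hp, hpΛ, q, hq, hqp, hd⟩
  rw [key]
  exact hT (measurableSet_singleton 0)

omit [Fintype d] in
/-- The superposition is the union of the thrown points restricted to `Λ × ℝᵈ` and of the boundary condition restricted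
to `Λᶜ × ℝᵈ`. [folklore] -/
theorem superposeIn_eq_union (Λ : Set 𝔼) {k : ℕ} (x : Fin k → 𝔼 × 𝔼) (Y : PointConfig (𝔼 × 𝔼)) :
    superposeIn Λ x Y = (PointConfig.ofFn x).restrict (Prod.fst ⁻¹' Λ) ∪ Y.restrict (Prod.fst ⁻¹' Λᶜ) := by
  ext y
  rfl

omit [Fintype d] in
/-- Membership in a superposition. [folklore] -/
theorem mem_superposeIn_iff (Λ : Set 𝔼) {k : ℕ} (x : Fin k → 𝔼 × 𝔼) (Y : PointConfig (𝔼 × 𝔼)) (p : 𝔼 × 𝔼) :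
    p ∈ superposeIn Λ x Y ↔ (p ∈ Set.range x ∧ p.1 ∈ Λ) ∨ (p ∈ Y ∧ p.1 ∉ Λ) :=
  Iff.rfl

/-- The finite configuration `{x₁, …, x_k}` depends measurably on `x`. [folklore] -/
theorem measurable_pointConfigOfFn (k : ℕ) : Measurable fun x : Fin k → 𝔼 × 𝔼 => PointConfig.ofFn x := by
  have h := (PointConfig.measurable_union_ofFn (E := 𝔼 × 𝔼) k).comp
    (measurable_id.prodMk (measurable_const (a := (∅ : PointConfig (𝔼 × 𝔼)))))
  convert h using 1
  funext x
  ext y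
  simp only [Function.comp_apply, id_eq, PointConfig.mem_union]
  constructor
  · exact fun hy => Or.inr hy
  · rintro (hy | hy)
    · exact absurd (show y ∈ (∅ : PointConfig (𝔼 × 𝔼)).carrier from hy) (by simp)
    · exact hy

/-- **Joint measurability of the superposition** `(x, Y) ↦ (x ∩ Λ) ∪ (Y ∩ Λᶜ)` for measurable `Λ`
(Richthammer 2007 §3.2). [cite: Richthammer2007, §3.2] -/
theorem measurable_superposeIn {Λ : Set 𝔼} (hΛ : MeasurableSet Λ) (k : ℕ) :
    Measurable fun p : (Fin k → 𝔼 × 𝔼) × PointConfig (𝔼 × 𝔼) => superposeIn Λ p.1 p.2 := by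
  have hΛ' : MeasurableSet (Prod.fst ⁻¹' Λ : Set (𝔼 × 𝔼)) := hΛ.preimage measurable_fst
  refine PointConfig.measurable_of_count fun s hs => ?_
  have hcount : ∀ p : (Fin k → 𝔼 × 𝔼) × PointConfig (𝔼 × 𝔼), (superposeIn Λ p.1 p.2).count s =
      (PointConfig.ofFn p.1).count (Prod.fst ⁻¹' Λ ∩ s) + p.2.count ((Prod.fst ⁻¹' Λ)ᶜ ∩ s) := fun p => by
    rw [superposeIn_eq_union, ← PointConfig.count_restrict, ← PointConfig.count_restrict]
    simp only [PointConfig.count, PointConfig.carrier_union, PointConfig.carrier_restrict, Set.union_inter_distrib_right]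
    rw [Set.encard_union_eq (Set.disjoint_left.2 fun y (hy : y ∈ ((PointConfig.ofFn p.1).carrier ∩ Prod.fst ⁻¹' Λ) ∩ s)
      (hy' : y ∈ (p.2.carrier ∩ Prod.fst ⁻¹' Λᶜ) ∩ s) => hy'.1.2 hy.1.2)]
    rfl
  simp_rw [hcount]
  have h1 : Measurable fun p : (Fin k → 𝔼 × 𝔼) × PointConfig (𝔼 × 𝔼) =>
      (PointConfig.ofFn p.1).count (Prod.fst ⁻¹' Λ ∩ s) :=
    (PointConfig.measurable_count (hΛ'.inter hs)).comp ((measurable_pointConfigOfFn k).comp measurable_fst)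
  have h2 : Measurable fun p : (Fin k → 𝔼 × 𝔼) × PointConfig (𝔼 × 𝔼) => p.2.count ((Prod.fst ⁻¹' Λ)ᶜ ∩ s) :=
    (PointConfig.measurable_count (hΛ'.compl.inter hs)).comp measurable_snd
  exact (measurable_of_countable fun q : ℕ∞ × ℕ∞ => q.1 + q.2).comp (h1.prodMk h2)

/-- For a fixed boundary condition, `x ↦ superposeIn Λ x Y` is measurable. [folklore] -/
theorem measurable_superposeIn_left {Λ : Set 𝔼} (hΛ : MeasurableSet Λ) (k : ℕ) (Y : PointConfig (𝔼 × 𝔼)) :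
    Measurable fun x : Fin k → 𝔼 × 𝔼 => superposeIn Λ x Y :=
  (measurable_superposeIn hΛ k).comp (measurable_id.prodMk measurable_const)

/-- The hard-core event of a superposition is jointly measurable in the thrown points and the boundary condition.
[folklore] -/
theorem measurableSet_hardCoreIn_superposeIn (ε : ℝ) {Λ : Set 𝔼} (hΛ : MeasurableSet Λ) (k : ℕ) :
    MeasurableSet {p : (Fin k → 𝔼 × 𝔼) × PointConfig (𝔼 × 𝔼) | HardCoreIn ε Λ (superposeIn Λ p.1 p.2)} :=
  (measurableSet_hardCoreIn ε hΛ).preimage (measurable_superposeIn hΛ k)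

/-- For a fixed boundary condition, the hard-core event is measurable in the thrown points. [folklore] -/
theorem measurableSet_hardCoreIn_superposeIn_left (ε : ℝ) {Λ : Set 𝔼} (hΛ : MeasurableSet Λ) (k : ℕ)
    (Y : PointConfig (𝔼 × 𝔼)) : MeasurableSet {x : Fin k → 𝔼 × 𝔼 | HardCoreIn ε Λ (superposeIn Λ x Y)} :=
  (measurableSet_hardCoreIn ε hΛ).preimage (measurable_superposeIn_left hΛ k Y)

omit [Fintype d] in
/-- At most `k` particles of `superposeIn Λ x Y` have position in `Λ` (the boundary condition is cut away from
`Λ × ℝᵈ`, and coincident thrown points merge). [folklore] -/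
theorem count_superposeIn_prod_univ_le (Λ : Set 𝔼) {k : ℕ} (x : Fin k → 𝔼 × 𝔼) (Y : PointConfig (𝔼 × 𝔼)) :
    (superposeIn Λ x Y).count (Λ ×ˢ (univ : Set 𝔼)) ≤ k := by
  classical
  have hsub : (superposeIn Λ x Y).carrier ∩ Λ ×ˢ (univ : Set 𝔼) ⊆ ((Finset.univ.image x : Finset (𝔼 × 𝔼)) : Set (𝔼 × 𝔼)) := by
    rintro p ⟨hp, hpΛ⟩
    rw [Finset.coe_image, Finset.coe_univ, Set.image_univ]
    rcases (mem_superposeIn_iff Λ x Y p).1 hp with ⟨hpx, -⟩ | ⟨-, hpc⟩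
    · exact hpx
    · exact absurd hpΛ.1 hpc
  calc (superposeIn Λ x Y).count (Λ ×ˢ (univ : Set 𝔼))
      ≤ ((Finset.univ.image x : Finset (𝔼 × 𝔼)) : Set (𝔼 × 𝔼)).encard := Set.encard_le_encard hsub
    _ = ((Finset.univ.image x).card : ℕ∞) := Set.encard_coe_eq_coe_finsetCard _
    _ ≤ k := by
        have h : (Finset.univ.image x).card ≤ k :=
          Finset.card_image_le.trans (by rw [Finset.card_univ, Fintype.card_fin])
        exact_mod_cast h

end HardCoreMeasurability

/-! ## The specification as a measure; measurability in the boundary condition -/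

section Specification

/-- The one-particle a-priori measure is σ-finite (a plain theorem, used via `haveI`). [folklore] -/
theorem sigmaFinite_maxwellPhaseMeasure (β : ℝ) (u : 𝔼) (Λ : Set 𝔼) : SigmaFinite (maxwellPhaseMeasure β u Λ) := by
  unfold Literature.Analysis.FluidPDE.maxwellPhaseMeasure
  infer_instance

/-- The integrand of the `k`-th term of `gibbsWeight`, in coordinates: the indicator of
`{x | superposeIn Λ x Y ∈ A} ∩ {x | hard core}`. [folklore] -/
theorem gibbsWeight_integrand_eq (ε : ℝ) (Λ : Set 𝔼) (Y : PointConfig (𝔼 × 𝔼)) (A : Set (PointConfig (𝔼 × 𝔼)))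
    {k : ℕ} (x : Fin k → 𝔼 × 𝔼) :
    (A ∩ {X | HardCoreIn ε Λ X}).indicator (1 : PointConfig (𝔼 × 𝔼) → ℝ≥0∞) (superposeIn Λ x Y) =
      ((fun x : Fin k → 𝔼 × 𝔼 => superposeIn Λ x Y) ⁻¹' A ∩ {x | HardCoreIn ε Λ (superposeIn Λ x Y)}).indicator 1 x :=
  rfl

/-- The integrand of `gibbsWeight … Y A` is jointly measurable in the thrown points and the boundary condition.
[folklore] -/
theorem measurable_gibbsWeight_integrand (ε : ℝ) {Λ : Set 𝔼} (hΛ : MeasurableSet Λ)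
    {A : Set (PointConfig (𝔼 × 𝔼))} (hA : MeasurableSet A) (k : ℕ) :
    Measurable fun p : (Fin k → 𝔼 × 𝔼) × PointConfig (𝔼 × 𝔼) =>
      (A ∩ {X | HardCoreIn ε Λ X}).indicator (1 : PointConfig (𝔼 × 𝔼) → ℝ≥0∞) (superposeIn Λ p.1 p.2) :=
  (measurable_one.indicator (hA.inter (measurableSet_hardCoreIn ε hΛ))).comp (measurable_superposeIn hΛ k)

/-- **The grand-canonical weight depends measurably on the boundary condition** (measurability part of Fubini,
term by term). [cite: Richthammer2007, §3.6 Lemma 6] -/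
theorem measurable_gibbsWeight (ε z β : ℝ) (u : 𝔼) {Λ : Set 𝔼} (hΛ : MeasurableSet Λ)
    {A : Set (PointConfig (𝔼 × 𝔼))} (hA : MeasurableSet A) :
    Measurable fun Y : PointConfig (𝔼 × 𝔼) => gibbsWeight ε z β u Λ Y A := by
  haveI := sigmaFinite_maxwellPhaseMeasure β u Λ
  unfold Literature.Analysis.FluidPDE.gibbsWeight
  refine Measurable.tsum fun k => Measurable.const_mul ?_ _
  exact (measurable_gibbsWeight_integrand ε hΛ hA k).lintegral_prod_left'

/-- **The specification `Y ↦ γ_Λ(A | Y)` is measurable** for measurable `Λ`, `A`. [cite: Richthammer2007, §3.6 Lemma 6] -/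
theorem measurable_gibbsSpec (ε z β : ℝ) (u : 𝔼) {Λ : Set 𝔼} (hΛ : MeasurableSet Λ)
    {A : Set (PointConfig (𝔼 × 𝔼))} (hA : MeasurableSet A) :
    Measurable fun Y : PointConfig (𝔼 × 𝔼) => gibbsSpec ε z β u Λ Y A := by
  unfold Literature.Analysis.FluidPDE.gibbsSpec
  exact (measurable_gibbsWeight ε z β u hΛ hA).div (measurable_gibbsWeight ε z β u hΛ MeasurableSet.univ)

/-- **The un-normalised grand-canonical weight as a measure** on configurations: the countable sum over `k` of
`(zᵏ/k!) ·` the push-forward under `x ↦ superposeIn Λ x Y` of the `k`-particle a-priori law restricted to the hard-core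
event (Alexander 1976 (2.1.1)). [cite: Alexander1976, §2.1 (2.1.1)] -/
def gibbsWeightMeasure (ε z β : ℝ) (u : 𝔼) (Λ : Set 𝔼) (Y : PointConfig (𝔼 × 𝔼)) : Measure (PointConfig (𝔼 × 𝔼)) :=
  Measure.sum fun k : ℕ => ENNReal.ofReal (z ^ k / (Nat.factorial k)) •
    ((Measure.pi fun _ : Fin k => maxwellPhaseMeasure β u Λ).restrict
      {x | HardCoreIn ε Λ (superposeIn Λ x Y)}).map (fun x => superposeIn Λ x Y)

/-- The weight measure evaluates to `gibbsWeight` on measurable events. [folklore] -/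
theorem gibbsWeightMeasure_apply (ε z β : ℝ) (u : 𝔼) {Λ : Set 𝔼} (hΛ : MeasurableSet Λ) (Y : PointConfig (𝔼 × 𝔼))
    {A : Set (PointConfig (𝔼 × 𝔼))} (hA : MeasurableSet A) :
    gibbsWeightMeasure ε z β u Λ Y A = gibbsWeight ε z β u Λ Y A := by
  rw [gibbsWeightMeasure, Measure.sum_apply _ hA]
  unfold Literature.Analysis.FluidPDE.gibbsWeight
  refine tsum_congr fun k => ?_
  have hf := measurable_superposeIn_left hΛ k Y
  rw [Measure.smul_apply, smul_eq_mul, Measure.map_apply hf hA, Measure.restrict_apply (hA.preimage hf),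
    ← lintegral_indicator_one ((hA.preimage hf).inter (measurableSet_hardCoreIn_superposeIn_left ε hΛ k Y))]
  simp_rw [gibbsWeight_integrand_eq]

/-- Integration against the weight measure, term by term. [folklore] -/
theorem lintegral_gibbsWeightMeasure (ε z β : ℝ) (u : 𝔼) {Λ : Set 𝔼} (hΛ : MeasurableSet Λ)
    (Y : PointConfig (𝔼 × 𝔼)) {F : PointConfig (𝔼 × 𝔼) → ℝ≥0∞} (hF : Measurable F) :
    ∫⁻ X, F X ∂(gibbsWeightMeasure ε z β u Λ Y) = ∑' k : ℕ, ENNReal.ofReal (z ^ k / (Nat.factorial k)) *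
      ∫⁻ x in {x | HardCoreIn ε Λ (superposeIn Λ x Y)}, F (superposeIn Λ x Y)
        ∂(Measure.pi fun _ : Fin k => maxwellPhaseMeasure β u Λ) := by
  rw [gibbsWeightMeasure, lintegral_sum_measure]
  refine tsum_congr fun k => ?_
  rw [lintegral_smul_measure, smul_eq_mul, lintegral_map hF (measurable_superposeIn_left hΛ k Y)]

/-- With no particle thrown, the superposition is hard-core compatible in `Λ`, so the `k = 0` term of the weight of
`univ` is `1`: **`1 ≤ gibbsWeight … Y univ`** for every boundary condition. [folklore] -/
theorem one_le_gibbsWeight_univ (ε z β : ℝ) (u : 𝔼) (Λ : Set 𝔼) (Y : PointConfig (𝔼 × 𝔼)) :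
    1 ≤ gibbsWeight ε z β u Λ Y univ := by
  haveI := sigmaFinite_maxwellPhaseMeasure β u Λ
  unfold Literature.Analysis.FluidPDE.gibbsWeight
  refine le_trans ?_ (ENNReal.le_tsum 0)
  have hind : ∀ x : Fin 0 → 𝔼 × 𝔼, (univ ∩ {X | HardCoreIn ε Λ X}).indicator (1 : PointConfig (𝔼 × 𝔼) → ℝ≥0∞)
      (superposeIn Λ x Y) = 1 := fun x =>
    Set.indicator_of_mem (show superposeIn Λ x Y ∈ univ ∩ {X | HardCoreIn ε Λ X} from
      ⟨mem_univ _, Literature.MathematicalPhysics.StatisticalMechanics.hardCoreIn_superposeIn_zero ε Λ x Y⟩) _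
  simp_rw [hind]
  rw [lintegral_const, Measure.pi_univ, Finset.univ_eq_empty, Finset.prod_empty, pow_zero, Nat.factorial_zero,
    Nat.cast_one, div_one, ENNReal.ofReal_one, one_mul, mul_one]

/-- The weight of `univ` never vanishes. [folklore] -/
theorem gibbsWeight_univ_ne_zero (ε z β : ℝ) (u : 𝔼) (Λ : Set 𝔼) (Y : PointConfig (𝔼 × 𝔼)) :
    gibbsWeight ε z β u Λ Y univ ≠ 0 :=
  (lt_of_lt_of_le one_pos (one_le_gibbsWeight_univ ε z β u Λ Y)).ne'

/-- **The finite-volume Gibbs specification `γ_Λ(· | Y)` as a measure** on configurations: the normalised weight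
measure (Alexander 1976 §2.1). [cite: Alexander1976, §2.1] -/
def gibbsSpecMeasure (ε z β : ℝ) (u : 𝔼) (Λ : Set 𝔼) (Y : PointConfig (𝔼 × 𝔼)) : Measure (PointConfig (𝔼 × 𝔼)) :=
  (gibbsWeight ε z β u Λ Y univ)⁻¹ • gibbsWeightMeasure ε z β u Λ Y

/-- The specification measure evaluates to `gibbsSpec` on measurable events. [folklore] -/
theorem gibbsSpecMeasure_apply (ε z β : ℝ) (u : 𝔼) {Λ : Set 𝔼} (hΛ : MeasurableSet Λ) (Y : PointConfig (𝔼 × 𝔼))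
    {A : Set (PointConfig (𝔼 × 𝔼))} (hA : MeasurableSet A) :
    gibbsSpecMeasure ε z β u Λ Y A = gibbsSpec ε z β u Λ Y A := by
  rw [gibbsSpecMeasure, Measure.smul_apply, smul_eq_mul, gibbsWeightMeasure_apply ε z β u hΛ Y hA,
    Literature.Analysis.FluidPDE.gibbsSpec, ENNReal.div_eq_inv_mul]

/-- Integration against the specification measure. [folklore] -/
theorem lintegral_gibbsSpecMeasure (ε z β : ℝ) (u : 𝔼) (Λ : Set 𝔼) (Y : PointConfig (𝔼 × 𝔼))
    (F : PointConfig (𝔼 × 𝔼) → ℝ≥0∞) :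
    ∫⁻ X, F X ∂(gibbsSpecMeasure ε z β u Λ Y) =
      (gibbsWeight ε z β u Λ Y univ)⁻¹ * ∫⁻ X, F X ∂(gibbsWeightMeasure ε z β u Λ Y) := by
  rw [gibbsSpecMeasure, lintegral_smul_measure, smul_eq_mul]

/-- **The specification is a measurable kernel in the boundary condition.** [cite: Richthammer2007, §3.6 Lemma 6] -/
theorem measurable_gibbsSpecMeasure (ε z β : ℝ) (u : 𝔼) {Λ : Set 𝔼} (hΛ : MeasurableSet Λ) :
    Measurable (gibbsSpecMeasure ε z β u Λ) := by
  refine Measure.measurable_of_measurable_coe _ fun A hA => ?_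
  simp_rw [gibbsSpecMeasure_apply ε z β u hΛ _ hA]
  exact measurable_gibbsSpec ε z β u hΛ hA

/-- The specification measure has total mass `≤ 1`. [folklore] -/
theorem gibbsSpecMeasure_univ_le_one (ε z β : ℝ) (u : 𝔼) {Λ : Set 𝔼} (hΛ : MeasurableSet Λ) (Y : PointConfig (𝔼 × 𝔼)) :
    gibbsSpecMeasure ε z β u Λ Y univ ≤ 1 := by
  rw [gibbsSpecMeasure_apply ε z β u hΛ Y MeasurableSet.univ, Literature.Analysis.FluidPDE.gibbsSpec]
  exact ENNReal.div_self_le_one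

/-- If the weight of `univ` is finite, the specification measure is a probability measure (a plain theorem).
[folklore] -/
theorem isProbabilityMeasure_gibbsSpecMeasure (ε z β : ℝ) (u : 𝔼) {Λ : Set 𝔼} (hΛ : MeasurableSet Λ)
    {Y : PointConfig (𝔼 × 𝔼)} (hY : gibbsWeight ε z β u Λ Y univ ≠ ∞) :
    IsProbabilityMeasure (gibbsSpecMeasure ε z β u Λ Y) := by
  refine ⟨?_⟩
  rw [gibbsSpecMeasure, Measure.smul_apply, smul_eq_mul, gibbsWeightMeasure_apply ε z β u hΛ Y MeasurableSet.univ]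
  exact ENNReal.inv_mul_cancel (gibbsWeight_univ_ne_zero ε z β u Λ Y) hY

/-! ## The DLR equation for functions -/

/-- **DLR as a fixed-point equation**: a hard-sphere Gibbs state is invariant under its specification kernel,
`μ.bind γ_Λ = μ`, for every bounded measurable window (Georgii 2011 Def. 1.23, `μ γ_Λ = μ`). [folklore] -/
theorem bind_gibbsSpecMeasure_of_isHardSphereGibbs {ε z β : ℝ} {u : 𝔼} {μ : Measure (PointConfig (𝔼 × 𝔼))}
    (h : IsHardSphereGibbs ε z β u μ) {Λ : Set 𝔼} (hΛ : MeasurableSet Λ) (hΛb : Bornology.IsBounded Λ) :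
    μ.bind (gibbsSpecMeasure ε z β u Λ) = μ := by
  ext A hA
  rw [Measure.bind_apply hA (measurable_gibbsSpecMeasure ε z β u hΛ).aemeasurable, h.2 Λ hΛ hΛb A hA]
  simp_rw [gibbsSpecMeasure_apply ε z β u hΛ _ hA]

/-- **The DLR equation for functions** (disintegration of a Gibbs state along its specification):
`∫⁻ F ∂μ = ∫⁻ Y, ∫⁻ F ∂γ_Λ(·|Y) ∂μ` for every `μ`-a.e.-measurable `F ≥ 0`. [folklore] -/
theorem lintegral_eq_lintegral_gibbsSpecMeasure {ε z β : ℝ} {u : 𝔼}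
    {μ : Measure (PointConfig (𝔼 × 𝔼))} (h : IsHardSphereGibbs ε z β u μ) {Λ : Set 𝔼} (hΛ : MeasurableSet Λ)
    (hΛb : Bornology.IsBounded Λ) {F : PointConfig (𝔼 × 𝔼) → ℝ≥0∞} (hF : AEMeasurable F μ) :
    ∫⁻ X, F X ∂μ = ∫⁻ Y, ∫⁻ X, F X ∂(gibbsSpecMeasure ε z β u Λ Y) ∂μ := by
  have hb := bind_gibbsSpecMeasure_of_isHardSphereGibbs h hΛ hΛb
  have hF' : AEMeasurable F (μ.bind (gibbsSpecMeasure ε z β u Λ)) := by rwa [hb]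
  calc ∫⁻ X, F X ∂μ = ∫⁻ X, F X ∂(μ.bind (gibbsSpecMeasure ε z β u Λ)) := by rw [hb]
    _ = ∫⁻ Y, ∫⁻ X, F X ∂(gibbsSpecMeasure ε z β u Λ Y) ∂μ :=
        Measure.lintegral_bind (measurable_gibbsSpecMeasure ε z β u hΛ).aemeasurable hF'

/-- A `μ`-a.e. property of configurations holds `γ_Λ(·|Y)`-a.e. for `μ`-a.e. boundary condition `Y`. [folklore] -/
theorem ae_ae_gibbsSpecMeasure_of_ae {ε z β : ℝ} {u : 𝔼} {μ : Measure (PointConfig (𝔼 × 𝔼))}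
    (h : IsHardSphereGibbs ε z β u μ) {Λ : Set 𝔼} (hΛ : MeasurableSet Λ) (hΛb : Bornology.IsBounded Λ)
    {p : PointConfig (𝔼 × 𝔼) → Prop} (hp : ∀ᵐ X ∂μ, p X) : ∀ᵐ Y ∂μ, ∀ᵐ X ∂(gibbsSpecMeasure ε z β u Λ Y), p X := by
  have hb := bind_gibbsSpecMeasure_of_isHardSphereGibbs h hΛ hΛb
  have hp' : ∀ᵐ X ∂(μ.bind (gibbsSpecMeasure ε z β u Λ)), p X := by rwa [hb]
  exact Measure.ae_ae_of_ae_bind (measurable_gibbsSpecMeasure ε z β u hΛ).aemeasurable hp'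

/-- **Under a Gibbs state the weight of `univ` is a.s. finite** (and `≥ 1`), so `γ_Λ(·|Y)` is a probability measure
for `μ`-a.e. `Y`: the DLR equation at `A = univ` reads `1 = ∫⁻ w/w ∂μ` with `w/w ≤ 1`. [folklore] -/
theorem ae_gibbsWeight_univ_ne_top {ε z β : ℝ} {u : 𝔼} {μ : Measure (PointConfig (𝔼 × 𝔼))}
    (h : IsHardSphereGibbs ε z β u μ) {Λ : Set 𝔼} (hΛ : MeasurableSet Λ) (hΛb : Bornology.IsBounded Λ) :
    ∀ᵐ Y ∂μ, gibbsWeight ε z β u Λ Y univ ≠ ∞ := by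
  haveI := h.1
  have hmeas := measurable_gibbsSpec ε z β u hΛ (MeasurableSet.univ : MeasurableSet (univ : Set (PointConfig (𝔼 × 𝔼))))
  have hle : ∀ Y : PointConfig (𝔼 × 𝔼), gibbsSpec ε z β u Λ Y univ ≤ 1 := fun Y => ENNReal.div_self_le_one
  have h1 : ∫⁻ Y, gibbsSpec ε z β u Λ Y univ ∂μ = 1 := by
    rw [← h.2 Λ hΛ hΛb univ MeasurableSet.univ, measure_univ]
  have h2 : ∫⁻ Y, (1 - gibbsSpec ε z β u Λ Y univ) ∂μ = 0 := by
    rw [lintegral_sub' hmeas.aemeasurable (by rw [h1]; exact ENNReal.one_ne_top) (ae_of_all _ hle), lintegral_const,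
      measure_univ, mul_one, h1, tsub_self]
  have h3 := (lintegral_eq_zero_iff' (aemeasurable_const.sub hmeas.aemeasurable)).1 h2
  filter_upwards [h3] with Y hY
  simp only [Pi.sub_apply, Pi.zero_apply, tsub_eq_zero_iff_le] at hY
  have hone : gibbsSpec ε z β u Λ Y univ = 1 := le_antisymm (hle Y) hY
  intro htop
  rw [Literature.Analysis.FluidPDE.gibbsSpec, htop, ENNReal.div_top] at hone
  exact zero_ne_one hone

/-- For `μ`-a.e. boundary condition the specification measure is a probability measure. [folklore] -/
theorem ae_isProbabilityMeasure_gibbsSpecMeasure {ε z β : ℝ} {u : 𝔼}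
    {μ : Measure (PointConfig (𝔼 × 𝔼))} (h : IsHardSphereGibbs ε z β u μ) {Λ : Set 𝔼} (hΛ : MeasurableSet Λ)
    (hΛb : Bornology.IsBounded Λ) : ∀ᵐ Y ∂μ, IsProbabilityMeasure (gibbsSpecMeasure ε z β u Λ Y) := by
  filter_upwards [ae_gibbsWeight_univ_ne_top h hΛ hΛb] with Y hY
  exact isProbabilityMeasure_gibbsSpecMeasure ε z β u hΛ hY

omit [Fintype d] in
/-- Counts are measurable as `ℝ≥0∞`-valued functions of the configuration. [folklore] -/
theorem measurable_toENNReal_count {s : Set (𝔼 × 𝔼)} (hs : MeasurableSet s) :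
    Measurable fun X : PointConfig (𝔼 × 𝔼) => ((X.count s : ℕ∞) : ℝ≥0∞) :=
  measurable_from_top.comp (PointConfig.measurable_count hs)

end Specification


/-! ## Deleting and inserting one thrown particle -/

section Insertion

/-- The hard core in a window is inherited by sub-configurations. [folklore] -/
theorem hardCoreIn_anti {ε : ℝ} {Λ : Set 𝔼} {X X' : PointConfig (𝔼 × 𝔼)} (h : ∀ p ∈ X, p ∈ X')
    (hX' : HardCoreIn ε Λ X') : HardCoreIn ε Λ X :=
  fun p hp q hq hpq hΛ => hX' p (h p hp) q (h q hq) hpq hΛ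

omit [Fintype d] in
/-- Membership in the superposition of `k + 1` thrown points `Fin.cons p x`: the new point (if its position is in `Λ`)
or a member of the superposition of `x`. [folklore] -/
theorem mem_superposeIn_cons_iff (Λ : Set 𝔼) {n : ℕ} (p : 𝔼 × 𝔼) (x : Fin n → 𝔼 × 𝔼) (Y : PointConfig (𝔼 × 𝔼))
    (a : 𝔼 × 𝔼) : a ∈ superposeIn Λ (Fin.cons p x : Fin (n + 1) → 𝔼 × 𝔼) Y ↔ (a = p ∧ p.1 ∈ Λ) ∨ a ∈ superposeIn Λ x Y := by
  rw [mem_superposeIn_iff, mem_superposeIn_iff, Fin.range_cons, Set.mem_insert_iff]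
  constructor
  · rintro (⟨rfl | ha, haΛ⟩ | h)
    · exact Or.inl ⟨rfl, haΛ⟩
    · exact Or.inr (Or.inl ⟨ha, haΛ⟩)
    · exact Or.inr (Or.inr h)
  · rintro (⟨rfl, hpΛ⟩ | ⟨ha, haΛ⟩ | h)
    · exact Or.inl ⟨Or.inl rfl, hpΛ⟩
    · exact Or.inl ⟨Or.inr ha, haΛ⟩
    · exact Or.inr h

/-- **Deleting a thrown particle keeps the hard core.** [folklore] -/
theorem hardCoreIn_superposeIn_of_cons {ε : ℝ} {Λ : Set 𝔼} {n : ℕ} {p : 𝔼 × 𝔼} {x : Fin n → 𝔼 × 𝔼}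
    {Y : PointConfig (𝔼 × 𝔼)} (h : HardCoreIn ε Λ (superposeIn Λ (Fin.cons p x : Fin (n + 1) → 𝔼 × 𝔼) Y)) :
    HardCoreIn ε Λ (superposeIn Λ x Y) :=
  hardCoreIn_anti (fun a ha => (mem_superposeIn_cons_iff Λ p x Y a).2 (Or.inr ha)) h

/-- **Inserting a particle into a vacant ball keeps the hard core**: if no particle of `superposeIn Λ x Y` has its centre in
the open ball `B(p.1, ε)`, throwing `p` in addition does not violate the hard core in `Λ`. [folklore] -/
theorem hardCoreIn_superposeIn_cons {ε : ℝ} {Λ : Set 𝔼} {n : ℕ} {p : 𝔼 × 𝔼} {x : Fin n → 𝔼 × 𝔼}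
    {Y : PointConfig (𝔼 × 𝔼)} (h : HardCoreIn ε Λ (superposeIn Λ x Y))
    (h0 : (superposeIn Λ x Y).count (Metric.ball p.1 ε ×ˢ (univ : Set 𝔼)) = 0) :
    HardCoreIn ε Λ (superposeIn Λ (Fin.cons p x : Fin (n + 1) → 𝔼 × 𝔼) Y) := by
  have hfar : ∀ b ∈ superposeIn Λ x Y, ε ≤ ‖p.1 - b.1‖ := by
    intro b hb
    rw [PointConfig.count, Set.encard_eq_zero, Set.eq_empty_iff_forall_notMem] at h0
    have hb' : b ∉ Metric.ball p.1 ε ×ˢ (univ : Set 𝔼) := fun hbS => h0 b ⟨hb, hbS⟩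
    rw [Set.mem_prod, Metric.mem_ball, not_and_or] at hb'
    rcases hb' with hb' | hb'
    · rw [not_lt, dist_eq_norm, norm_sub_rev] at hb'
      exact hb'
    · exact absurd (mem_univ _) hb'
  intro a ha b hb hab hΛ
  rcases (mem_superposeIn_cons_iff Λ p x Y a).1 ha with ⟨hap, -⟩ | ha' <;>
    rcases (mem_superposeIn_cons_iff Λ p x Y b).1 hb with ⟨hbp, -⟩ | hb'
  · exact absurd (hap.trans hbp.symm) hab
  · rw [hap]; exact hfar b hb'
  · rw [hbp, norm_sub_rev]; exact hfar a ha'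
  · exact h a ha' b hb' hab hΛ

omit [Fintype d] in
/-- If the thrown points are distinct with positions in `Λ`, exactly `k` particles of the superposition lie above `Λ`.
[folklore] -/
theorem count_superposeIn_eq_of_injective (Λ : Set 𝔼) {n : ℕ} {x : Fin n → 𝔼 × 𝔼} (hx : ∀ i, (x i).1 ∈ Λ)
    (hinj : Function.Injective x) (Y : PointConfig (𝔼 × 𝔼)) :
    (superposeIn Λ x Y).count (Λ ×ˢ (univ : Set 𝔼)) = n := by
  have hset : (superposeIn Λ x Y).carrier ∩ Λ ×ˢ (univ : Set 𝔼) = Set.range x := by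
    ext a
    simp only [mem_inter_iff, PointConfig.mem_carrier, mem_superposeIn_iff, mem_prod, mem_univ, and_true]
    constructor
    · rintro ⟨⟨ha, -⟩ | ⟨-, haΛ⟩, haΛ'⟩
      · exact ha
      · exact absurd haΛ' haΛ
    · rintro ⟨i, rfl⟩
      exact ⟨Or.inl ⟨⟨i, rfl⟩, hx i⟩, hx i⟩
  rw [PointConfig.count, hset, ← Set.image_univ, hinj.injOn.encard_image, Set.encard_univ, ENat.card_eq_coe_fintype_card,
    Fintype.card_fin]

end Insertion

/-! ## Splitting off one coordinate of the `k + 1`-fold a-priori law -/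

section Split

variable (m : Measure (EuclideanSpace ℝ d × EuclideanSpace ℝ d)) [SigmaFinite m] -- no local notation in `variable`

omit [Fintype d] in
/-- The inverse of `piFinSuccAbove` at the coordinate `0` is `Fin.cons`. [folklore] -/
theorem piFinSuccAbove_zero_symm_apply' (n : ℕ) (q : (𝔼 × 𝔼) × (Fin n → 𝔼 × 𝔼)) :
    (MeasurableEquiv.piFinSuccAbove (fun _ : Fin (n + 1) => 𝔼 × 𝔼) 0).symm q = Fin.cons q.1 q.2 := by
  simp [MeasurableEquiv.piFinSuccAbove, Fin.insertNthEquiv, Fin.insertNth_zero']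

omit [Fintype d] in
/-- `(p, x) ↦ Fin.cons p x` is measurable. [folklore] -/
theorem measurable_finCons' (n : ℕ) :
    Measurable fun q : (𝔼 × 𝔼) × (Fin n → 𝔼 × 𝔼) => (Fin.cons q.1 q.2 : Fin (n + 1) → 𝔼 × 𝔼) := by
  have h := (MeasurableEquiv.piFinSuccAbove (fun _ : Fin (n + 1) => 𝔼 × 𝔼) 0).symm.measurable
  refine (congrArg Measurable (funext fun q => ?_)).mp h
  exact piFinSuccAbove_zero_symm_apply' n q

omit [Fintype d] in
/-- **Fubini for the first thrown point**: `∫ f dm^{⊗(k+1)} = ∫ f(cons p x) d(m ⊗ m^{⊗k})(p, x)`. [folklore] -/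
theorem lintegral_prod_pi_cons (n : ℕ) (f : (Fin (n + 1) → 𝔼 × 𝔼) → ℝ≥0∞) :
    ∫⁻ q, f (Fin.cons q.1 q.2) ∂(m.prod (Measure.pi fun _ : Fin n => m)) = ∫⁻ x, f x ∂(Measure.pi fun _ : Fin (n + 1) => m) := by
  have hmp := measurePreserving_piFinSuccAbove (fun _ : Fin (n + 1) => m) 0
  set e := MeasurableEquiv.piFinSuccAbove (fun _ : Fin (n + 1) => 𝔼 × 𝔼) 0 with he
  have h1 : (fun q : (𝔼 × 𝔼) × (Fin n → 𝔼 × 𝔼) => f (Fin.cons q.1 q.2)) = fun q => f (e.symm q) := by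
    funext q
    rw [piFinSuccAbove_zero_symm_apply']
  rw [h1, ← hmp.lintegral_comp_emb e.measurableEmbedding (fun q => f (e.symm q))]
  simp only [MeasurableEquiv.symm_apply_apply]

omit [Fintype d] in
/-- The `m^{⊗(k+1)}`-measure of a set is the `m ⊗ m^{⊗k}`-measure of its preimage under `cons`. [folklore] -/
theorem pi_succ_apply_eq_prod (n : ℕ) (S : Set (Fin (n + 1) → 𝔼 × 𝔼)) :
    (Measure.pi fun _ : Fin (n + 1) => m) S =
      (m.prod (Measure.pi fun _ : Fin n => m)) ((fun q : (𝔼 × 𝔼) × (Fin n → 𝔼 × 𝔼) => (Fin.cons q.1 q.2 : Fin (n + 1) → 𝔼 × 𝔼)) ⁻¹' S) := by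
  have hmp := (measurePreserving_piFinSuccAbove (fun _ : Fin (n + 1) => m) 0).symm
  rw [← hmp.measure_preimage_equiv S]
  congr 1
  ext q
  simp only [mem_preimage, piFinSuccAbove_zero_symm_apply']

/-- **Deleting a particle**: `m^{⊗(k+1)}{hard core} ≤ m(univ) · m^{⊗k}{hard core}`. [folklore] -/
theorem pi_hardCore_succ_le (ε : ℝ) (Λ : Set 𝔼) (Y : PointConfig (𝔼 × 𝔼)) (n : ℕ) :
    (Measure.pi fun _ : Fin (n + 1) => m) {x | HardCoreIn ε Λ (superposeIn Λ x Y)} ≤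
      m univ * (Measure.pi fun _ : Fin n => m) {x | HardCoreIn ε Λ (superposeIn Λ x Y)} := by
  rw [pi_succ_apply_eq_prod, ← Measure.prod_prod]
  exact measure_mono fun q hq => ⟨mem_univ _, hardCoreIn_superposeIn_of_cons hq⟩

/-- Coincidences of two thrown points are `m^{⊗k}`-null when `m` has no atoms. [folklore] -/
theorem pi_setOf_apply_eq_apply_eq_zero (hm : ∀ a, m {a} = 0) {n : ℕ} {i j : Fin n} (hij : i ≠ j) :
    (Measure.pi fun _ : Fin n => m) {x | x i = x j} = 0 := by
  cases n with
  | zero => exact i.elim0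
  | succ n =>
    obtain ⟨j₀, rfl⟩ := Fin.exists_succAbove_eq hij.symm
    have hmp := measurePreserving_piFinSuccAbove (fun _ : Fin (n + 1) => m) i
    set e := MeasurableEquiv.piFinSuccAbove (fun _ : Fin (n + 1) => 𝔼 × 𝔼) i with he
    have hset : {x : Fin (n + 1) → 𝔼 × 𝔼 | x i = x (i.succAbove j₀)} =
        e ⁻¹' {q : (𝔼 × 𝔼) × (Fin n → 𝔼 × 𝔼) | q.1 = q.2 j₀} := by
      ext x
      simp [he, MeasurableEquiv.piFinSuccAbove_apply, Fin.insertNthEquiv_symm_apply, Fin.removeNth_apply]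
    have hT : MeasurableSet {q : (𝔼 × 𝔼) × (Fin n → 𝔼 × 𝔼) | q.1 = q.2 j₀} :=
      measurableSet_eq_fun measurable_fst ((measurable_pi_apply j₀).comp measurable_snd)
    rw [hset, hmp.measure_preimage_equiv, Measure.measure_prod_null hT]
    refine ae_of_all _ fun a => ?_
    have h1 : Prod.mk a ⁻¹' {q : (𝔼 × 𝔼) × (Fin n → 𝔼 × 𝔼) | q.1 = q.2 j₀} =
        (Function.eval j₀ : (Fin n → 𝔼 × 𝔼) → 𝔼 × 𝔼) ⁻¹' {a} := by
      ext y
      simp only [mem_preimage, mem_setOf_eq, mem_singleton_iff, eq_comm]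
    simp only [Pi.zero_apply, h1]
    exact Measure.pi_eval_preimage_null (fun _ : Fin n => m) (hm a)

end Split

/-! ## The one-particle a-priori law -/

section APriori

/-- The Maxwellian velocity factor `M_β(v - u) dv` of the a-priori law is, for `β > 0`, the law of `u + β^{-1/2} ξ`,
`ξ ~ N(0, I_d)`: in particular a probability measure. [folklore] -/
theorem withDensity_maxwellianBeta_eq_map_stdGaussian {β : ℝ} (hβ : 0 < β) (u : 𝔼) :
    (volume : Measure 𝔼).withDensity (fun v => ENNReal.ofReal (maxwellianBeta β (v - u))) =
      (stdGaussian 𝔼).map (fun ξ => u + Real.sqrt β⁻¹ • ξ) := by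
  rw [← withDensity_localMaxwellian_eq_map_stdGaussian (E := 𝔼) (inv_pos.2 hβ) u]
  congr 1
  funext v
  simp only [maxwellianBeta, Literature.Analysis.FluidPDE.localMaxwellian, sub_zero]

/-- The Maxwellian velocity factor is a probability measure for `β > 0`. [folklore] -/
theorem isProbabilityMeasure_withDensity_maxwellianBeta {β : ℝ} (hβ : 0 < β) (u : 𝔼) :
    IsProbabilityMeasure ((volume : Measure 𝔼).withDensity (fun v => ENNReal.ofReal (maxwellianBeta β (v - u)))) := by
  rw [withDensity_maxwellianBeta_eq_map_stdGaussian hβ u]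
  exact Measure.isProbabilityMeasure_map (by fun_prop)

/-- The a-priori law is `Leb|_Λ ⊗ (M_β(v-u) dv)` (unfolding lemma). [folklore] -/
theorem maxwellPhaseMeasure_eq_prod (β : ℝ) (u : 𝔼) (Λ : Set 𝔼) :
    maxwellPhaseMeasure β u Λ = ((volume : Measure 𝔼).restrict Λ).prod
      ((volume : Measure 𝔼).withDensity fun v => ENNReal.ofReal (maxwellianBeta β (v - u))) :=
  rfl

/-- Total mass of the a-priori law: `m(univ) = vol Λ` for `β > 0` (the Maxwellian is a probability density). [folklore] -/
theorem maxwellPhaseMeasure_univ {β : ℝ} (hβ : 0 < β) (u : 𝔼) (Λ : Set 𝔼) :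
    maxwellPhaseMeasure β u Λ univ = volume Λ := by
  haveI := isProbabilityMeasure_withDensity_maxwellianBeta hβ u
  rw [maxwellPhaseMeasure_eq_prod, ← univ_prod_univ, Measure.prod_prod, Measure.restrict_apply_univ, measure_univ, mul_one]

/-- The a-priori law does not charge `Λᶜ × ℝᵈ`. [folklore] -/
theorem maxwellPhaseMeasure_compl (β : ℝ) (u : 𝔼) {Λ : Set 𝔼} (hΛ : MeasurableSet Λ) :
    maxwellPhaseMeasure β u Λ (Prod.fst ⁻¹' Λᶜ) = 0 := by
  rw [maxwellPhaseMeasure_eq_prod, ← Set.prod_univ, Measure.prod_prod, Measure.restrict_apply hΛ.compl,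
    Set.compl_inter_self, measure_empty, zero_mul]

/-- The a-priori law has no atoms (positive dimension). [folklore] -/
theorem maxwellPhaseMeasure_singleton [Nonempty d] (β : ℝ) (u : 𝔼) (Λ : Set 𝔼) (a : 𝔼 × 𝔼) :
    maxwellPhaseMeasure β u Λ {a} = 0 := by
  have h0 : ((volume : Measure 𝔼).restrict Λ) {a.1} = 0 :=
    nonpos_iff_eq_zero.1 ((Measure.le_iff'.1 Measure.restrict_le_self {a.1}).trans_eq (measure_singleton a.1))
  rw [maxwellPhaseMeasure_eq_prod, show ({a} : Set (𝔼 × 𝔼)) = {a.1} ×ˢ {a.2} by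
    rw [singleton_prod_singleton], Measure.prod_prod, h0, zero_mul]

/-- Under `m^{⊗k}` a.s. all thrown positions lie in `Λ`. [folklore] -/
theorem ae_pi_maxwellPhaseMeasure_fst_mem (β : ℝ) (u : 𝔼) {Λ : Set 𝔼} (hΛ : MeasurableSet Λ) (n : ℕ) :
    ∀ᵐ x ∂(Measure.pi fun _ : Fin n => maxwellPhaseMeasure β u Λ), ∀ i, (x i).1 ∈ Λ := by
  haveI := sigmaFinite_maxwellPhaseMeasure β u Λ
  refine ae_all_iff.2 fun i => ?_
  rw [ae_iff]
  exact Measure.pi_eval_preimage_null (fun _ : Fin n => maxwellPhaseMeasure β u Λ) (i := i)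
    (maxwellPhaseMeasure_compl β u hΛ)

/-- **Under `m^{⊗k}` a.s. all thrown positions lie in `Λ` and the thrown points are pairwise distinct** (positive
dimension). [folklore] -/
theorem ae_pi_maxwellPhaseMeasure_good [Nonempty d] (β : ℝ) (u : 𝔼) {Λ : Set 𝔼} (hΛ : MeasurableSet Λ) (n : ℕ) :
    ∀ᵐ x ∂(Measure.pi fun _ : Fin n => maxwellPhaseMeasure β u Λ), (∀ i, (x i).1 ∈ Λ) ∧ Function.Injective x := by
  haveI := sigmaFinite_maxwellPhaseMeasure β u Λ
  set m := maxwellPhaseMeasure β u Λ with hm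
  have h2 : ∀ᵐ x ∂(Measure.pi fun _ : Fin n => m), ∀ i j, i ≠ j → x i ≠ x j := by
    refine ae_all_iff.2 fun i => ae_all_iff.2 fun j => ?_
    by_cases hij : i = j
    · exact ae_of_all _ fun x h => absurd hij h
    · have h0 := pi_setOf_apply_eq_apply_eq_zero m (maxwellPhaseMeasure_singleton β u Λ) hij
      have h0' : ∀ᵐ x ∂(Measure.pi fun _ : Fin n => m), x i ≠ x j := by
        rw [ae_iff]
        simpa only [ne_eq, not_not] using h0
      filter_upwards [h0'] with x hx using fun _ => hx
  filter_upwards [ae_pi_maxwellPhaseMeasure_fst_mem β u hΛ n, h2] with x hx1 hx2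
  exact ⟨hx1, fun i j hij => by_contra fun h => hx2 i j h hij⟩

end APriori

/-! ## The upper bound: `E_{γ(·|Y)}[#Λ] ≤ z · m(univ)` (Ruelle's `ρ_Λ ≤ z`) -/

section Upper

/-- The normalising weight as a series of hard-core masses: `w(Y) = ∑ₖ (zᵏ/k!) m^{⊗k}{hard core}`. [folklore] -/
theorem gibbsWeight_univ_eq_tsum (ε z β : ℝ) (u : 𝔼) {Λ : Set 𝔼} (hΛ : MeasurableSet Λ) (Y : PointConfig (𝔼 × 𝔼)) :
    gibbsWeight ε z β u Λ Y univ = ∑' k : ℕ, ENNReal.ofReal (z ^ k / (Nat.factorial k)) *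
      (Measure.pi fun _ : Fin k => maxwellPhaseMeasure β u Λ) {x | HardCoreIn ε Λ (superposeIn Λ x Y)} := by
  calc gibbsWeight ε z β u Λ Y univ = gibbsWeightMeasure ε z β u Λ Y univ :=
        (gibbsWeightMeasure_apply ε z β u hΛ Y MeasurableSet.univ).symm
    _ = ∫⁻ _, 1 ∂(gibbsWeightMeasure ε z β u Λ Y) := lintegral_one.symm
    _ = _ := by
        rw [lintegral_gibbsWeightMeasure ε z β u hΛ Y measurable_const]
        simp only [setLIntegral_one]

omit [Fintype d] in
/-- `(z^{k+1}/(k+1)!) (k+1) = z · zᵏ/k!` in `ℝ≥0∞`, for `z ≥ 0`. [folklore] -/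
theorem ofReal_pow_succ_div_factorial_mul {z : ℝ} (hz : 0 ≤ z) (n : ℕ) :
    ENNReal.ofReal (z ^ (n + 1) / (Nat.factorial (n + 1))) * ((n + 1 : ℕ) : ℝ≥0∞) =
      ENNReal.ofReal z * ENNReal.ofReal (z ^ n / (Nat.factorial n)) := by
  rw [← ENNReal.ofReal_natCast, ← ENNReal.ofReal_mul (by positivity), ← ENNReal.ofReal_mul hz]
  congr 1
  rw [Nat.factorial_succ, Nat.cast_mul]
  have hf : (0 : ℝ) < (Nat.factorial n : ℕ) := by positivity
  have hn : (0 : ℝ) < ((n + 1 : ℕ) : ℝ) := by positivity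
  field_simp
  ring

/-- **`E_{W(·|Y)}[#Λ] ≤ z · m(univ) · w(Y)`** (Ruelle 1969 (2.5) at the level of the un-normalised weight): at most `k`
particles above `Λ` in the `k`-th term, and `k (zᵏ/k!) m^{⊗k}{hc} ≤ z m(univ) (z^{k-1}/(k-1)!) m^{⊗(k-1)}{hc}`.
[cite: Ruelle1969, §4.2 (2.5)] -/
theorem lintegral_count_gibbsWeightMeasure_le_activity (ε : ℝ) {z : ℝ} (hz : 0 ≤ z) (β : ℝ) (u : 𝔼) {Λ : Set 𝔼}
    (hΛ : MeasurableSet Λ) (Y : PointConfig (𝔼 × 𝔼)) :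
    ∫⁻ X, ((X.count (Λ ×ˢ (univ : Set 𝔼)) : ℕ∞) : ℝ≥0∞) ∂(gibbsWeightMeasure ε z β u Λ Y) ≤
      ENNReal.ofReal z * maxwellPhaseMeasure β u Λ univ * gibbsWeight ε z β u Λ Y univ := by
  haveI := sigmaFinite_maxwellPhaseMeasure β u Λ
  rw [lintegral_gibbsWeightMeasure ε z β u hΛ Y (measurable_toENNReal_count (hΛ.prod MeasurableSet.univ)),
    gibbsWeight_univ_eq_tsum ε z β u hΛ Y]
  set m := maxwellPhaseMeasure β u Λ with hm
  set P : ℕ → ℝ≥0∞ := fun k => (Measure.pi fun _ : Fin k => m) {x | HardCoreIn ε Λ (superposeIn Λ x Y)} with hP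
  set c : ℕ → ℝ≥0∞ := fun k => ENNReal.ofReal (z ^ k / (Nat.factorial k)) with hc
  set N : ℕ → ℝ≥0∞ := fun k => ∫⁻ x in {x : Fin k → 𝔼 × 𝔼 | HardCoreIn ε Λ (superposeIn Λ x Y)},
      (((superposeIn Λ x Y).count (Λ ×ˢ (univ : Set 𝔼)) : ℕ∞) : ℝ≥0∞) ∂(Measure.pi fun _ : Fin k => m) with hN
  show ∑' k, c k * N k ≤ ENNReal.ofReal z * m univ * ∑' k, c k * P k
  have hterm : ∀ k : ℕ, N k ≤ k * P k := by
    intro k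
    calc N k ≤ ∫⁻ _ in {x : Fin k → 𝔼 × 𝔼 | HardCoreIn ε Λ (superposeIn Λ x Y)}, (k : ℝ≥0∞)
          ∂(Measure.pi fun _ : Fin k => m) :=
          lintegral_mono fun x =>
            (ENat.toENNReal_le.2 (count_superposeIn_prod_univ_le Λ x Y)).trans_eq (ENat.toENNReal_coe k)
      _ = k * P k := setLIntegral_const _ _
  have hsucc : ∀ n : ℕ, c (n + 1) * (((n + 1 : ℕ) : ℝ≥0∞) * P (n + 1)) ≤ ENNReal.ofReal z * m univ * (c n * P n) := by
    intro n
    calc c (n + 1) * (((n + 1 : ℕ) : ℝ≥0∞) * P (n + 1)) = ENNReal.ofReal z * c n * P (n + 1) := by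
          rw [← mul_assoc, hc]
          dsimp only
          rw [ofReal_pow_succ_div_factorial_mul hz n]
      _ ≤ ENNReal.ofReal z * c n * (m univ * P n) := mul_le_mul' le_rfl (pi_hardCore_succ_le m ε Λ Y n)
      _ = _ := by ring
  calc ∑' k, c k * N k ≤ ∑' k, c k * ((k : ℝ≥0∞) * P k) := ENNReal.tsum_le_tsum fun k => mul_le_mul' le_rfl (hterm k)
    _ = c 0 * (((0 : ℕ) : ℝ≥0∞) * P 0) + ∑' n : ℕ, c (n + 1) * (((n + 1 : ℕ) : ℝ≥0∞) * P (n + 1)) :=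
        tsum_eq_zero_add' ENNReal.summable
    _ = ∑' n : ℕ, c (n + 1) * (((n + 1 : ℕ) : ℝ≥0∞) * P (n + 1)) := by
        rw [Nat.cast_zero, zero_mul, mul_zero, zero_add]
    _ ≤ ∑' n : ℕ, ENNReal.ofReal z * m univ * (c n * P n) := ENNReal.tsum_le_tsum hsucc
    _ = ENNReal.ofReal z * m univ * ∑' n : ℕ, c n * P n := ENNReal.tsum_mul_left

/-- **`E_{γ(·|Y)}[#Λ] ≤ z · m(univ)`** for every boundary condition (Ruelle 1969 (2.5), `ρ_Λ(x) ≤ z`).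
[cite: Ruelle1969, §4.2 (2.5)] -/
theorem lintegral_count_gibbsSpecMeasure_le_activity (ε : ℝ) {z : ℝ} (hz : 0 ≤ z) (β : ℝ) (u : 𝔼) {Λ : Set 𝔼}
    (hΛ : MeasurableSet Λ) (Y : PointConfig (𝔼 × 𝔼)) :
    ∫⁻ X, ((X.count (Λ ×ˢ (univ : Set 𝔼)) : ℕ∞) : ℝ≥0∞) ∂(gibbsSpecMeasure ε z β u Λ Y) ≤
      ENNReal.ofReal z * maxwellPhaseMeasure β u Λ univ := by
  rw [lintegral_gibbsSpecMeasure]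
  by_cases hw : gibbsWeight ε z β u Λ Y univ = ∞
  · rw [hw, ENNReal.inv_top, zero_mul]
    exact zero_le
  calc (gibbsWeight ε z β u Λ Y univ)⁻¹ * ∫⁻ X, ((X.count (Λ ×ˢ (univ : Set 𝔼)) : ℕ∞) : ℝ≥0∞) ∂(gibbsWeightMeasure ε z β u Λ Y)
      ≤ (gibbsWeight ε z β u Λ Y univ)⁻¹ *
          (ENNReal.ofReal z * maxwellPhaseMeasure β u Λ univ * gibbsWeight ε z β u Λ Y univ) :=
        mul_le_mul' le_rfl (lintegral_count_gibbsWeightMeasure_le_activity ε hz β u hΛ Y)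
    _ = ENNReal.ofReal z * maxwellPhaseMeasure β u Λ univ *
          ((gibbsWeight ε z β u Λ Y univ)⁻¹ * gibbsWeight ε z β u Λ Y univ) := by ring
    _ = _ := by rw [ENNReal.inv_mul_cancel (gibbsWeight_univ_ne_zero ε z β u Λ Y) hw, mul_one]

/-- **Intensity bound for a Gibbs state, sharp form**: `E_μ[#(particles above Λ)] ≤ z · m(Λ × ℝᵈ)` for every bounded
measurable window (no hypothesis on `β`; `m` the one-particle a-priori law). [cite: Ruelle1969, §4.2 (2.5)] -/
theorem lintegral_count_le_activity_mul_mass {ε z β : ℝ} {u : 𝔼} {μ : Measure (PointConfig (𝔼 × 𝔼))}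
    (h : IsHardSphereGibbs ε z β u μ) (hz : 0 ≤ z) {Λ : Set 𝔼} (hΛ : MeasurableSet Λ) (hΛb : Bornology.IsBounded Λ) :
    ∫⁻ X, ((X.count (Λ ×ˢ (univ : Set 𝔼)) : ℕ∞) : ℝ≥0∞) ∂μ ≤ ENNReal.ofReal z * maxwellPhaseMeasure β u Λ univ := by
  haveI := h.1
  rw [lintegral_eq_lintegral_gibbsSpecMeasure h hΛ hΛb
    (measurable_toENNReal_count (hΛ.prod MeasurableSet.univ)).aemeasurable]
  calc ∫⁻ Y, ∫⁻ X, ((X.count (Λ ×ˢ (univ : Set 𝔼)) : ℕ∞) : ℝ≥0∞) ∂(gibbsSpecMeasure ε z β u Λ Y) ∂μ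
      ≤ ∫⁻ _, ENNReal.ofReal z * maxwellPhaseMeasure β u Λ univ ∂μ :=
        lintegral_mono fun Y => lintegral_count_gibbsSpecMeasure_le_activity ε hz β u hΛ Y
    _ = _ := by rw [lintegral_const, show μ univ = 1 from measure_univ, mul_one]

/-- **`E_μ[#(particles above Λ)] ≤ z · vol Λ`** for a hard-sphere Gibbs state of activity `z ≥ 0` at `β > 0`
(Ruelle 1969 (2.5)/(2.35): the one-point correlation function is `≤ z`). [cite: Ruelle1969, §4.2 (2.5)] -/
theorem lintegral_count_le_activity_mul_volume {ε z β : ℝ} {u : 𝔼} {μ : Measure (PointConfig (𝔼 × 𝔼))}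
    (h : IsHardSphereGibbs ε z β u μ) (hz : 0 ≤ z) (hβ : 0 < β) {Λ : Set 𝔼} (hΛ : MeasurableSet Λ)
    (hΛb : Bornology.IsBounded Λ) :
    ∫⁻ X, ((X.count (Λ ×ˢ (univ : Set 𝔼)) : ℕ∞) : ℝ≥0∞) ∂μ ≤ ENNReal.ofReal z * volume Λ := by
  rw [← maxwellPhaseMeasure_univ hβ u Λ]
  exact lintegral_count_le_activity_mul_mass h hz hΛ hΛb

end Upper


/-! ## The lower bound: `z · m(univ) ≤ E_{γ(·|Y)}[#Λ] + z · E_{γ(·|Y)}[blocked volume]` (GNZ insertion) -/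

section Lower

/-- **Parametrised ball counts are measurable**: `a ↦ N_{B(g a, ε) × ℝᵈ}(X a)` (the number of particles of `X a` with
centre in the open ball `B(g a, ε)`, in `ℝ≥0∞`) is measurable for measurable `X`, `g`. [folklore] -/
theorem measurable_ballCount {α : Type*} [MeasurableSpace α] (ε : ℝ) {X : α → PointConfig (𝔼 × 𝔼)} {g : α → 𝔼}
    (hX : Measurable X) (hg : Measurable g) :
    Measurable fun a => (((X a).count (Metric.ball (g a) ε ×ˢ (univ : Set 𝔼)) : ℕ∞) : ℝ≥0∞) := by
  have ht : MeasurableSet {r : α × (𝔼 × 𝔼) | dist r.2.1 (g r.1) < ε} :=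
    measurableSet_lt (measurable_snd.fst.dist (hg.comp measurable_fst)) measurable_const
  have h := PointConfig.measurable_toMeasure_preimage ht hX
  refine (congrArg Measurable (funext fun a => ?_)).mp h
  rw [PointConfig.toMeasure_apply _ (measurable_prodMk_left ht)]
  congr 2
  ext p
  simp only [mem_preimage, mem_setOf_eq, mem_prod, Metric.mem_ball, mem_univ, and_true]

/-- The **blocked volume** `D(X) = ∫ N_{B(p.1, ε) × ℝᵈ}(X) m(dp)` of a configuration in the window (`m` the one-particle
a-priori law) is a measurable function of the configuration. [folklore] -/
theorem measurable_blockedVolume (ε β : ℝ) (u : 𝔼) (Λ : Set 𝔼) :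
    Measurable fun X : PointConfig (𝔼 × 𝔼) =>
      ∫⁻ p, ((X.count (Metric.ball p.1 ε ×ˢ (univ : Set 𝔼)) : ℕ∞) : ℝ≥0∞) ∂(maxwellPhaseMeasure β u Λ) := by
  haveI := sigmaFinite_maxwellPhaseMeasure β u Λ
  exact (measurable_ballCount ε measurable_fst measurable_snd.fst).lintegral_prod_right'

/-- **The GNZ insertion inequality, pointwise**: `1[hc](x) ≤ 1[hc](cons p x) + 1[hc](x) · N_{B(p.1,ε) × ℝᵈ}(superposeIn Λ x Y)`
(either the ball around the new centre is vacant, and the insertion keeps the hard core, or it holds a particle).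
[cite: Dereudre2019, Thm 2 and Prop. 10] -/
theorem indicator_hardCore_le_cons (ε : ℝ) (Λ : Set 𝔼) {n : ℕ} (x : Fin n → 𝔼 × 𝔼) (p : 𝔼 × 𝔼)
    (Y : PointConfig (𝔼 × 𝔼)) :
    {x : Fin n → 𝔼 × 𝔼 | HardCoreIn ε Λ (superposeIn Λ x Y)}.indicator (1 : (Fin n → 𝔼 × 𝔼) → ℝ≥0∞) x ≤
      {x' : Fin (n + 1) → 𝔼 × 𝔼 | HardCoreIn ε Λ (superposeIn Λ x' Y)}.indicator 1 (Fin.cons p x) +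
        {x : Fin n → 𝔼 × 𝔼 | HardCoreIn ε Λ (superposeIn Λ x Y)}.indicator 1 x *
          (((superposeIn Λ x Y).count (Metric.ball p.1 ε ×ˢ (univ : Set 𝔼)) : ℕ∞) : ℝ≥0∞) := by
  by_cases hx : HardCoreIn ε Λ (superposeIn Λ x Y)
  · rw [indicator_of_mem (show x ∈ {x : Fin n → 𝔼 × 𝔼 | HardCoreIn ε Λ (superposeIn Λ x Y)} from hx), Pi.one_apply,
      one_mul]
    by_cases h0 : (superposeIn Λ x Y).count (Metric.ball p.1 ε ×ˢ (univ : Set 𝔼)) = 0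
    · rw [indicator_of_mem (show (Fin.cons p x : Fin (n + 1) → 𝔼 × 𝔼) ∈
        {x' : Fin (n + 1) → 𝔼 × 𝔼 | HardCoreIn ε Λ (superposeIn Λ x' Y)} from hardCoreIn_superposeIn_cons hx h0),
        Pi.one_apply]
      exact le_self_add
    · have h1 : (1 : ℝ≥0∞) ≤ (((superposeIn Λ x Y).count (Metric.ball p.1 ε ×ˢ (univ : Set 𝔼)) : ℕ∞) : ℝ≥0∞) := by
        rw [← ENat.toENNReal_one, ENat.toENNReal_le, Order.one_le_iff_ne_zero]
        exact h0
      exact h1.trans le_add_self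
  · rw [indicator_of_notMem (show x ∉ {x : Fin n → 𝔼 × 𝔼 | HardCoreIn ε Λ (superposeIn Λ x Y)} from hx)]
    exact zero_le

/-- **The GNZ insertion inequality for the `k`-particle a-priori masses**:
`m(univ) · m^{⊗k}{hc} ≤ m^{⊗(k+1)}{hc} + ∫_{hc} D(superposeIn Λ x Y) m^{⊗k}(dx)`. [cite: Dereudre2019, Thm 2 and Prop. 10] -/
theorem mass_mul_pi_hardCore_le (ε β : ℝ) (u : 𝔼) {Λ : Set 𝔼} (hΛ : MeasurableSet Λ) (Y : PointConfig (𝔼 × 𝔼))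
    (n : ℕ) :
    maxwellPhaseMeasure β u Λ univ *
        (Measure.pi fun _ : Fin n => maxwellPhaseMeasure β u Λ) {x | HardCoreIn ε Λ (superposeIn Λ x Y)} ≤
      (Measure.pi fun _ : Fin (n + 1) => maxwellPhaseMeasure β u Λ) {x | HardCoreIn ε Λ (superposeIn Λ x Y)} +
        ∫⁻ x in {x : Fin n → 𝔼 × 𝔼 | HardCoreIn ε Λ (superposeIn Λ x Y)},
          ∫⁻ p, (((superposeIn Λ x Y).count (Metric.ball p.1 ε ×ˢ (univ : Set 𝔼)) : ℕ∞) : ℝ≥0∞) ∂(maxwellPhaseMeasure β u Λ)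
          ∂(Measure.pi fun _ : Fin n => maxwellPhaseMeasure β u Λ) := by
  haveI := sigmaFinite_maxwellPhaseMeasure β u Λ
  set m := maxwellPhaseMeasure β u Λ with hm
  set Hn : Set (Fin n → 𝔼 × 𝔼) := {x | HardCoreIn ε Λ (superposeIn Λ x Y)} with hHn
  set Hs : Set (Fin (n + 1) → 𝔼 × 𝔼) := {x | HardCoreIn ε Λ (superposeIn Λ x Y)} with hHs
  have hHnm : MeasurableSet Hn := measurableSet_hardCoreIn_superposeIn_left ε hΛ n Y
  have hHsm : MeasurableSet Hs := measurableSet_hardCoreIn_superposeIn_left ε hΛ (n + 1) Y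
  have hA : Measurable fun q : (𝔼 × 𝔼) × (Fin n → 𝔼 × 𝔼) =>
      Hs.indicator (1 : (Fin (n + 1) → 𝔼 × 𝔼) → ℝ≥0∞) (Fin.cons q.1 q.2) :=
    (measurable_one.indicator hHsm).comp (measurable_finCons' n)
  have hXb : Measurable fun q : (𝔼 × 𝔼) × (Fin n → 𝔼 × 𝔼) =>
      (((superposeIn Λ q.2 Y).count (Metric.ball q.1.1 ε ×ˢ (univ : Set 𝔼)) : ℕ∞) : ℝ≥0∞) :=
    measurable_ballCount ε ((measurable_superposeIn_left hΛ n Y).comp measurable_snd) measurable_fst.fst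
  have hB : Measurable fun q : (𝔼 × 𝔼) × (Fin n → 𝔼 × 𝔼) => Hn.indicator (1 : (Fin n → 𝔼 × 𝔼) → ℝ≥0∞) q.2 *
      (((superposeIn Λ q.2 Y).count (Metric.ball q.1.1 ε ×ˢ (univ : Set 𝔼)) : ℕ∞) : ℝ≥0∞) :=
    ((measurable_one.indicator hHnm).comp measurable_snd).mul hXb
  calc m univ * (Measure.pi fun _ : Fin n => m) Hn
      = (m.prod (Measure.pi fun _ : Fin n => m)) (univ ×ˢ Hn) := (Measure.prod_prod _ _).symm
    _ = ∫⁻ q, (univ ×ˢ Hn).indicator 1 q ∂(m.prod (Measure.pi fun _ : Fin n => m)) :=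
        (lintegral_indicator_one (MeasurableSet.univ.prod hHnm)).symm
    _ ≤ ∫⁻ q, (Hs.indicator 1 (Fin.cons q.1 q.2) + Hn.indicator 1 q.2 *
          (((superposeIn Λ q.2 Y).count (Metric.ball q.1.1 ε ×ˢ (univ : Set 𝔼)) : ℕ∞) : ℝ≥0∞))
          ∂(m.prod (Measure.pi fun _ : Fin n => m)) := by
        refine lintegral_mono fun q => ?_
        have hq : (univ ×ˢ Hn).indicator (1 : (𝔼 × 𝔼) × (Fin n → 𝔼 × 𝔼) → ℝ≥0∞) q = Hn.indicator 1 q.2 := by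
          by_cases h : q.2 ∈ Hn
          · rw [indicator_of_mem h, indicator_of_mem (show q ∈ univ ×ˢ Hn from ⟨mem_univ _, h⟩)]
            rfl
          · rw [indicator_of_notMem h, indicator_of_notMem (fun h' : q ∈ univ ×ˢ Hn => h h'.2)]
        rw [hq]
        exact indicator_hardCore_le_cons ε Λ q.2 q.1 Y
    _ = ∫⁻ q, Hs.indicator 1 (Fin.cons q.1 q.2) ∂(m.prod (Measure.pi fun _ : Fin n => m)) +
          ∫⁻ q, Hn.indicator 1 q.2 * (((superposeIn Λ q.2 Y).count (Metric.ball q.1.1 ε ×ˢ (univ : Set 𝔼)) : ℕ∞) : ℝ≥0∞)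
            ∂(m.prod (Measure.pi fun _ : Fin n => m)) :=
        lintegral_add_left hA _
    _ = (Measure.pi fun _ : Fin (n + 1) => m) Hs +
          ∫⁻ x in Hn, ∫⁻ p, (((superposeIn Λ x Y).count (Metric.ball p.1 ε ×ˢ (univ : Set 𝔼)) : ℕ∞) : ℝ≥0∞) ∂m
            ∂(Measure.pi fun _ : Fin n => m) := by
        congr 1
        · rw [lintegral_prod_pi_cons m n (Hs.indicator 1), lintegral_indicator_one hHsm]
        · rw [lintegral_prod_symm _ hB.aemeasurable, ← lintegral_indicator hHnm]
          refine lintegral_congr fun x => ?_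
          by_cases hx : x ∈ Hn
          · simp only [indicator_of_mem hx, Pi.one_apply, one_mul]
          · simp only [indicator_of_notMem hx, zero_mul, lintegral_zero]

/-- **`z · m(univ) · w(Y) ≤ E_W[#Λ] + z · E_W[D]`** (the GNZ insertion inequality summed against the weights `zᵏ/k!`,
with `(k+1) z^{k+1}/(k+1)! = z · zᵏ/k!` and, `m^{⊗k}`-a.e., exactly `k` particles above `Λ`; positive dimension).
[cite: Dereudre2019, Thm 2 and Prop. 10] -/
theorem activity_mul_mass_le_gibbsWeightMeasure [Nonempty d] (ε : ℝ) {z : ℝ} (hz : 0 ≤ z) (β : ℝ) (u : 𝔼)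
    {Λ : Set 𝔼} (hΛ : MeasurableSet Λ) (Y : PointConfig (𝔼 × 𝔼)) :
    ENNReal.ofReal z * maxwellPhaseMeasure β u Λ univ * gibbsWeight ε z β u Λ Y univ ≤
      ∫⁻ X, ((X.count (Λ ×ˢ (univ : Set 𝔼)) : ℕ∞) : ℝ≥0∞) ∂(gibbsWeightMeasure ε z β u Λ Y) +
        ENNReal.ofReal z * ∫⁻ X, ∫⁻ p, ((X.count (Metric.ball p.1 ε ×ˢ (univ : Set 𝔼)) : ℕ∞) : ℝ≥0∞) ∂(maxwellPhaseMeasure β u Λ)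
          ∂(gibbsWeightMeasure ε z β u Λ Y) := by
  haveI := sigmaFinite_maxwellPhaseMeasure β u Λ
  rw [lintegral_gibbsWeightMeasure ε z β u hΛ Y (measurable_toENNReal_count (hΛ.prod MeasurableSet.univ)),
    lintegral_gibbsWeightMeasure ε z β u hΛ Y (measurable_blockedVolume ε β u Λ), gibbsWeight_univ_eq_tsum ε z β u hΛ Y]
  set m := maxwellPhaseMeasure β u Λ with hm
  set P : ℕ → ℝ≥0∞ := fun k => (Measure.pi fun _ : Fin k => m) {x | HardCoreIn ε Λ (superposeIn Λ x Y)} with hP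
  set c : ℕ → ℝ≥0∞ := fun k => ENNReal.ofReal (z ^ k / (Nat.factorial k)) with hc
  set N : ℕ → ℝ≥0∞ := fun k => ∫⁻ x in {x : Fin k → 𝔼 × 𝔼 | HardCoreIn ε Λ (superposeIn Λ x Y)},
      (((superposeIn Λ x Y).count (Λ ×ˢ (univ : Set 𝔼)) : ℕ∞) : ℝ≥0∞) ∂(Measure.pi fun _ : Fin k => m) with hN
  set B : ℕ → ℝ≥0∞ := fun k => ∫⁻ x in {x : Fin k → 𝔼 × 𝔼 | HardCoreIn ε Λ (superposeIn Λ x Y)},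
      ∫⁻ p, (((superposeIn Λ x Y).count (Metric.ball p.1 ε ×ˢ (univ : Set 𝔼)) : ℕ∞) : ℝ≥0∞) ∂m
        ∂(Measure.pi fun _ : Fin k => m) with hB
  show ENNReal.ofReal z * m univ * ∑' k, c k * P k ≤ ∑' k, c k * N k + ENNReal.ofReal z * ∑' k, c k * B k
  -- a.e. exactly `k` particles above `Λ`
  have hcount : ∀ k : ℕ, N k = k * P k := by
    intro k
    rw [hN, hP]
    dsimp only
    rw [← setLIntegral_const]
    refine setLIntegral_congr_fun_ae (measurableSet_hardCoreIn_superposeIn_left ε hΛ k Y) ?_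
    filter_upwards [ae_pi_maxwellPhaseMeasure_good β u hΛ k] with x hx _
    rw [count_superposeIn_eq_of_injective Λ hx.1 hx.2 Y, ENat.toENNReal_coe]
  have hstep : ∀ n : ℕ, ENNReal.ofReal z * m univ * (c n * P n) ≤
      c (n + 1) * (((n + 1 : ℕ) : ℝ≥0∞) * P (n + 1)) + ENNReal.ofReal z * (c n * B n) := by
    intro n
    calc ENNReal.ofReal z * m univ * (c n * P n) = ENNReal.ofReal z * c n * (m univ * P n) := by ring
      _ ≤ ENNReal.ofReal z * c n * (P (n + 1) + B n) := mul_le_mul' le_rfl (mass_mul_pi_hardCore_le ε β u hΛ Y n)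
      _ = ENNReal.ofReal z * c n * P (n + 1) + ENNReal.ofReal z * (c n * B n) := by ring
      _ = _ := by
          rw [hc]
          dsimp only
          rw [← ofReal_pow_succ_div_factorial_mul hz n]
          ring
  calc ENNReal.ofReal z * m univ * ∑' k, c k * P k = ∑' k, ENNReal.ofReal z * m univ * (c k * P k) :=
        ENNReal.tsum_mul_left.symm
    _ ≤ ∑' n, (c (n + 1) * (((n + 1 : ℕ) : ℝ≥0∞) * P (n + 1)) + ENNReal.ofReal z * (c n * B n)) :=
        ENNReal.tsum_le_tsum hstep
    _ = ∑' n, c (n + 1) * (((n + 1 : ℕ) : ℝ≥0∞) * P (n + 1)) + ∑' n, ENNReal.ofReal z * (c n * B n) := ENNReal.tsum_add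
    _ = ∑' k, c k * ((k : ℝ≥0∞) * P k) + ENNReal.ofReal z * ∑' n, c n * B n := by
        congr 1
        · rw [tsum_eq_zero_add' (f := fun k => c k * ((k : ℝ≥0∞) * P k)) ENNReal.summable, Nat.cast_zero, zero_mul,
            mul_zero, zero_add]
        · exact ENNReal.tsum_mul_left
    _ = ∑' k, c k * N k + ENNReal.ofReal z * ∑' n, c n * B n := by
        simp_rw [hcount]

/-- **`z · m(univ) ≤ E_{γ(·|Y)}[#Λ] + z · E_{γ(·|Y)}[D]`** for every boundary condition of finite weight (positive
dimension). [cite: Dereudre2019, Thm 2 and Prop. 10] -/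
theorem activity_mul_mass_le_gibbsSpecMeasure [Nonempty d] (ε : ℝ) {z : ℝ} (hz : 0 ≤ z) (β : ℝ) (u : 𝔼) {Λ : Set 𝔼}
    (hΛ : MeasurableSet Λ) {Y : PointConfig (𝔼 × 𝔼)} (hY : gibbsWeight ε z β u Λ Y univ ≠ ∞) :
    ENNReal.ofReal z * maxwellPhaseMeasure β u Λ univ ≤
      ∫⁻ X, ((X.count (Λ ×ˢ (univ : Set 𝔼)) : ℕ∞) : ℝ≥0∞) ∂(gibbsSpecMeasure ε z β u Λ Y) +
        ENNReal.ofReal z * ∫⁻ X, ∫⁻ p, ((X.count (Metric.ball p.1 ε ×ˢ (univ : Set 𝔼)) : ℕ∞) : ℝ≥0∞) ∂(maxwellPhaseMeasure β u Λ)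
          ∂(gibbsSpecMeasure ε z β u Λ Y) := by
  set w := gibbsWeight ε z β u Λ Y univ with hw
  have hw0 : w ≠ 0 := gibbsWeight_univ_ne_zero ε z β u Λ Y
  rw [lintegral_gibbsSpecMeasure, lintegral_gibbsSpecMeasure]
  calc ENNReal.ofReal z * maxwellPhaseMeasure β u Λ univ = w⁻¹ * (ENNReal.ofReal z * maxwellPhaseMeasure β u Λ univ * w) := by
        rw [mul_comm w⁻¹, mul_assoc, ENNReal.mul_inv_cancel hw0 hY, mul_one]
    _ ≤ w⁻¹ * (∫⁻ X, ((X.count (Λ ×ˢ (univ : Set 𝔼)) : ℕ∞) : ℝ≥0∞) ∂(gibbsWeightMeasure ε z β u Λ Y) +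
          ENNReal.ofReal z * ∫⁻ X, ∫⁻ p, ((X.count (Metric.ball p.1 ε ×ˢ (univ : Set 𝔼)) : ℕ∞) : ℝ≥0∞)
            ∂(maxwellPhaseMeasure β u Λ) ∂(gibbsWeightMeasure ε z β u Λ Y)) :=
        mul_le_mul' le_rfl (activity_mul_mass_le_gibbsWeightMeasure ε hz β u hΛ Y)
    _ = _ := by rw [mul_add]; ring

/-- **`z · m(univ) ≤ E_μ[#Λ] + z · E_μ[D]`** for a hard-sphere Gibbs state (DLR for functions on both sides; positive
dimension). [cite: Dereudre2019, Thm 2 and Prop. 10] -/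
theorem activity_mul_mass_le_of_isHardSphereGibbs [Nonempty d] {ε z β : ℝ} {u : 𝔼} {μ : Measure (PointConfig (𝔼 × 𝔼))}
    (h : IsHardSphereGibbs ε z β u μ) (hz : 0 ≤ z) {Λ : Set 𝔼} (hΛ : MeasurableSet Λ)
    (hΛb : Bornology.IsBounded Λ) :
    ENNReal.ofReal z * maxwellPhaseMeasure β u Λ univ ≤
      ∫⁻ X, ((X.count (Λ ×ˢ (univ : Set 𝔼)) : ℕ∞) : ℝ≥0∞) ∂μ +
        ENNReal.ofReal z * ∫⁻ X, ∫⁻ p, ((X.count (Metric.ball p.1 ε ×ˢ (univ : Set 𝔼)) : ℕ∞) : ℝ≥0∞) ∂(maxwellPhaseMeasure β u Λ) ∂μ := by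
  haveI := h.1
  have hcm := measurable_toENNReal_count (hΛ.prod (MeasurableSet.univ : MeasurableSet (univ : Set 𝔼)))
  have hDm := measurable_blockedVolume ε β u Λ
  have h1 : Measurable fun Y => ∫⁻ X, ((X.count (Λ ×ˢ (univ : Set 𝔼)) : ℕ∞) : ℝ≥0∞) ∂(gibbsSpecMeasure ε z β u Λ Y) :=
    (Measure.measurable_lintegral hcm).comp (measurable_gibbsSpecMeasure ε z β u hΛ)
  have h2 : Measurable fun Y => ∫⁻ X, ∫⁻ p, ((X.count (Metric.ball p.1 ε ×ˢ (univ : Set 𝔼)) : ℕ∞) : ℝ≥0∞)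
      ∂(maxwellPhaseMeasure β u Λ) ∂(gibbsSpecMeasure ε z β u Λ Y) :=
    (Measure.measurable_lintegral hDm).comp (measurable_gibbsSpecMeasure ε z β u hΛ)
  rw [lintegral_eq_lintegral_gibbsSpecMeasure h hΛ hΛb hcm.aemeasurable,
    lintegral_eq_lintegral_gibbsSpecMeasure h hΛ hΛb hDm.aemeasurable, ← lintegral_const_mul _ h2,
    ← lintegral_add_left h1]
  calc ENNReal.ofReal z * maxwellPhaseMeasure β u Λ univ = ∫⁻ _, ENNReal.ofReal z * maxwellPhaseMeasure β u Λ univ ∂μ := by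
        rw [lintegral_const, show μ univ = 1 from measure_univ, mul_one]
    _ ≤ _ := lintegral_mono_ae ?_
  filter_upwards [ae_gibbsWeight_univ_ne_top h hΛ hΛb] with Y hY
  exact activity_mul_mass_le_gibbsSpecMeasure ε hz β u hΛ hY

/-- The mean blocked volume is the `Λ`-integral of the mean number of centres in the balls `B(q, ε)` (Tonelli; the
velocity factor of the a-priori law is a probability measure for `β > 0`). [folklore] -/
theorem lintegral_blockedVolume_eq (ε : ℝ) {β : ℝ} (hβ : 0 < β) (u : 𝔼) (Λ : Set 𝔼)
    (μ : Measure (PointConfig (𝔼 × 𝔼))) [SFinite μ] :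
    ∫⁻ X, ∫⁻ p, ((X.count (Metric.ball p.1 ε ×ˢ (univ : Set 𝔼)) : ℕ∞) : ℝ≥0∞) ∂(maxwellPhaseMeasure β u Λ) ∂μ =
      ∫⁻ q in Λ, ∫⁻ X, ((X.count (Metric.ball q ε ×ˢ (univ : Set 𝔼)) : ℕ∞) : ℝ≥0∞) ∂μ := by
  haveI := sigmaFinite_maxwellPhaseMeasure β u Λ
  haveI := isProbabilityMeasure_withDensity_maxwellianBeta hβ u
  have hg : Measurable fun q : 𝔼 => ∫⁻ X, ((X.count (Metric.ball q ε ×ˢ (univ : Set 𝔼)) : ℕ∞) : ℝ≥0∞) ∂μ :=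
    (measurable_ballCount ε measurable_fst measurable_snd).lintegral_prod_left'
  have hsw : AEMeasurable (uncurry fun (X : PointConfig (𝔼 × 𝔼)) (p : 𝔼 × 𝔼) =>
      ((X.count (Metric.ball p.1 ε ×ˢ (univ : Set 𝔼)) : ℕ∞) : ℝ≥0∞)) (μ.prod (maxwellPhaseMeasure β u Λ)) :=
    (measurable_ballCount ε measurable_fst measurable_snd.fst).aemeasurable
  rw [lintegral_lintegral_swap hsw, maxwellPhaseMeasure_eq_prod β u Λ,
    lintegral_prod (fun p : 𝔼 × 𝔼 => ∫⁻ X, ((X.count (Metric.ball p.1 ε ×ˢ (univ : Set 𝔼)) : ℕ∞) : ℝ≥0∞) ∂μ)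
      (hg.comp measurable_fst).aemeasurable]
  simp only [lintegral_const, measure_univ, mul_one]

/-- **The GNZ lower bound, window form** (Nguyen–Zessin 1979 Thm 2, first-order consequence): for a hard-sphere Gibbs
state `μ` of diameter `ε`, activity `z ≥ 0`, `β > 0`, in positive dimension, and a bounded measurable window `Λ`,
`z · vol Λ ≤ E_μ[#(particles above Λ)] + z ∫_Λ E_μ[#(particles with centre in B(q, ε))] dq`.
[cite: Dereudre2019, Thm 2 and Prop. 10] -/
theorem activity_mul_volume_le_of_isHardSphereGibbs [Nonempty d] {ε z β : ℝ} {u : 𝔼}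
    {μ : Measure (PointConfig (𝔼 × 𝔼))} (h : IsHardSphereGibbs ε z β u μ) (hz : 0 ≤ z) (hβ : 0 < β) {Λ : Set 𝔼}
    (hΛ : MeasurableSet Λ) (hΛb : Bornology.IsBounded Λ) :
    ENNReal.ofReal z * volume Λ ≤ ∫⁻ X, ((X.count (Λ ×ˢ (univ : Set 𝔼)) : ℕ∞) : ℝ≥0∞) ∂μ +
      ENNReal.ofReal z * ∫⁻ q in Λ, ∫⁻ X, ((X.count (Metric.ball q ε ×ˢ (univ : Set 𝔼)) : ℕ∞) : ℝ≥0∞) ∂μ := by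
  haveI := h.1
  rw [← maxwellPhaseMeasure_univ hβ u Λ, ← lintegral_blockedVolume_eq ε hβ u Λ μ]
  exact activity_mul_mass_le_of_isHardSphereGibbs h hz hΛ hΛb

end Lower


/-! ## Translation invariance: every translated unit cube carries the density -/

section Translation

open Literature.Analysis.FunctionSpaces.Torus (unitCube measurableSet_unitCube)
open Literature.MathematicalPhysics.KineticTheory.PointProcess (density)

omit [Fintype d] in
/-- The density is the mean number of particles above the unit cube (product form of the cylinder). [folklore] -/
theorem density_eq_lintegral_count (μ : Measure (PointConfig (𝔼 × 𝔼))) :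
    density μ = ∫⁻ X, ((X.count (unitCube d ×ˢ (univ : Set 𝔼)) : ℕ∞) : ℝ≥0∞) ∂μ := by
  simp only [density, Set.prod_univ]

/-- **Under a translation-invariant law every translated unit cube `a + [0,1)^d` carries the density.** [folklore] -/
theorem lintegral_count_cube_eq_density {μ : Measure (PointConfig (𝔼 × 𝔼))} (hTI : IsTranslationInvariant μ) (a : 𝔼) :
    ∫⁻ X, ((X.count (((fun x => x - a) ⁻¹' unitCube d) ×ˢ (univ : Set 𝔼)) : ℕ∞) : ℝ≥0∞) ∂μ = density μ := by
  have hset : ((fun x : 𝔼 => x - a) ⁻¹' unitCube d) ×ˢ (univ : Set 𝔼) =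
      (fun p : 𝔼 × 𝔼 => p + (-a, 0)) ⁻¹' (unitCube d ×ˢ (univ : Set 𝔼)) := by
    ext p
    simp only [mem_prod, mem_preimage, mem_univ, and_true, Prod.fst_add, sub_eq_add_neg]
  have hcount : ∀ X : PointConfig (𝔼 × 𝔼),
      X.count (((fun x : 𝔼 => x - a) ⁻¹' unitCube d) ×ˢ (univ : Set 𝔼)) =
        (X.translate ((-a, 0) : 𝔼 × 𝔼)).count (unitCube d ×ˢ (univ : Set 𝔼)) := fun X => by
    rw [PointConfig.count_translate, hset]
  simp_rw [hcount]
  rw [← lintegral_map (measurable_toENNReal_count (measurableSet_unitCube.prod MeasurableSet.univ))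
    (PointConfig.measurable_translate ((-a, 0) : 𝔼 × 𝔼)), hTI (-a), density_eq_lintegral_count]

/-- The ball `B(q, ε)`, `2ε ≤ n`, is covered by the `n^d` translated unit cubes `q - ε𝟙 + k + [0,1)^d`, `k ∈ {0,…,n-1}^d`.
[folklore] -/
theorem ball_subset_iUnion_cube (q : 𝔼) {ε : ℝ} {n : ℕ} (hn : 2 * ε ≤ n) :
    Metric.ball q ε ⊆ ⋃ k : d → Fin n,
      (fun x : 𝔼 => x - (WithLp.toLp 2 fun i => q i - ε + ((k i : ℕ) : ℝ))) ⁻¹' unitCube d := by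
  intro y hy
  rw [Metric.mem_ball, dist_eq_norm] at hy
  have hyi : ∀ i, |y i - q i| < ε := fun i => by
    have h := PiLp.norm_apply_le (y - q) i
    rw [PiLp.sub_apply, Real.norm_eq_abs] at h
    exact h.trans_lt hy
  have ht0 : ∀ i, 0 ≤ y i - q i + ε := fun i => by
    have h := (abs_lt.1 (hyi i)).1
    linarith
  have ht1 : ∀ i, y i - q i + ε < n := fun i => by
    have h := (abs_lt.1 (hyi i)).2
    linarith
  have hk : ∀ i, ⌊y i - q i + ε⌋₊ < n := fun i => by
    have h := (Nat.floor_le (ht0 i)).trans_lt (ht1 i)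
    exact_mod_cast h
  refine Set.mem_iUnion.2 ⟨fun i => ⟨⌊y i - q i + ε⌋₊, hk i⟩, ?_⟩
  rw [mem_preimage, Literature.Analysis.FunctionSpaces.Torus.mem_unitCube]
  intro i
  have h1 := Nat.floor_le (ht0 i)
  have h2 := Nat.lt_floor_add_one (y i - q i + ε)
  simp only [PiLp.sub_apply, mem_Ico]
  constructor <;> linarith

/-- **The exclusion ball holds at most `n^d ρ` centres on average**: under a translation-invariant law, for `2ε ≤ n`,
`E_μ[#(particles with centre in B(q, ε))] ≤ n^d · density μ`. [folklore] -/
theorem lintegral_count_ball_le_density {μ : Measure (PointConfig (𝔼 × 𝔼))} (hTI : IsTranslationInvariant μ) (q : 𝔼)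
    {ε : ℝ} {n : ℕ} (hn : 2 * ε ≤ n) :
    ∫⁻ X, ((X.count (Metric.ball q ε ×ˢ (univ : Set 𝔼)) : ℕ∞) : ℝ≥0∞) ∂μ ≤ ((n ^ Fintype.card d : ℕ) : ℝ≥0∞) * density μ := by
  classical
  set cube : (d → Fin n) → Set 𝔼 := fun k =>
    (fun x : 𝔼 => x - (WithLp.toLp 2 fun i => q i - ε + ((k i : ℕ) : ℝ))) ⁻¹' unitCube d with hcube
  have hcubem : ∀ k, MeasurableSet (cube k ×ˢ (univ : Set 𝔼)) := fun k =>
    ((measurable_id.sub measurable_const) measurableSet_unitCube).prod MeasurableSet.univ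
  have hballm : MeasurableSet (Metric.ball q ε ×ˢ (univ : Set 𝔼)) := Metric.isOpen_ball.measurableSet.prod MeasurableSet.univ
  have hpt : ∀ X : PointConfig (𝔼 × 𝔼), ((X.count (Metric.ball q ε ×ˢ (univ : Set 𝔼)) : ℕ∞) : ℝ≥0∞) ≤
      ∑ k : d → Fin n, ((X.count (cube k ×ˢ (univ : Set 𝔼)) : ℕ∞) : ℝ≥0∞) := by
    intro X
    have hsub : Metric.ball q ε ×ˢ (univ : Set 𝔼) ⊆ ⋃ k : d → Fin n, cube k ×ˢ (univ : Set 𝔼) := by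
      rintro p ⟨hp, -⟩
      obtain ⟨k, hk⟩ := Set.mem_iUnion.1 (ball_subset_iUnion_cube q hn hp)
      exact Set.mem_iUnion.2 ⟨k, hk, mem_univ _⟩
    calc ((X.count (Metric.ball q ε ×ˢ (univ : Set 𝔼)) : ℕ∞) : ℝ≥0∞) = X.toMeasure (Metric.ball q ε ×ˢ (univ : Set 𝔼)) :=
          (PointConfig.toMeasure_apply X hballm).symm
      _ ≤ X.toMeasure (⋃ k : d → Fin n, cube k ×ˢ (univ : Set 𝔼)) := measure_mono hsub
      _ ≤ ∑ k : d → Fin n, X.toMeasure (cube k ×ˢ (univ : Set 𝔼)) := measure_iUnion_fintype_le _ _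
      _ = _ := Finset.sum_congr rfl fun k _ => PointConfig.toMeasure_apply X (hcubem k)
  calc ∫⁻ X, ((X.count (Metric.ball q ε ×ˢ (univ : Set 𝔼)) : ℕ∞) : ℝ≥0∞) ∂μ
      ≤ ∫⁻ X, ∑ k : d → Fin n, ((X.count (cube k ×ˢ (univ : Set 𝔼)) : ℕ∞) : ℝ≥0∞) ∂μ := lintegral_mono hpt
    _ = ∑ k : d → Fin n, ∫⁻ X, ((X.count (cube k ×ˢ (univ : Set 𝔼)) : ℕ∞) : ℝ≥0∞) ∂μ :=
        lintegral_finsetSum _ fun k _ => measurable_toENNReal_count (hcubem k)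
    _ = ∑ _k : d → Fin n, density μ := Finset.sum_congr rfl fun k _ => lintegral_count_cube_eq_density hTI _
    _ = ((n ^ Fintype.card d : ℕ) : ℝ≥0∞) * density μ := by
        rw [Finset.sum_const, Finset.card_univ, Fintype.card_fun, Fintype.card_fin, nsmul_eq_mul]

end Translation

/-! ## The density sandwich -/

section Sandwich

open Literature.Analysis.FunctionSpaces.Torus (unitCube measurableSet_unitCube)
open Literature.MathematicalPhysics.KineticTheory.PointProcess (density)

/- The unit cube `Torus.unitCube d = [0,1)^d` is, definitionally, the cell `StatisticalMechanics.unitCube` of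
`SpecificRelativeEntropy.lean`, whose boundedness and unit volume we use through `show`. -/

/-- **Upper bound `ρ ≤ z`**: the density of a hard-sphere Gibbs state (any diameter, any dimension, `β > 0`) is at most its
activity (Ruelle 1969 (2.5)/(2.35): `ρ_Λ(x) ≤ z`, in the DLR setting). [cite: Ruelle1969, §4.2 (2.5)] -/
theorem density_le_activity {ε z β : ℝ} {u : 𝔼} {μ : Measure (PointConfig (𝔼 × 𝔼))} (h : IsHardSphereGibbs ε z β u μ)
    (hz : 0 ≤ z) (hβ : 0 < β) : density μ ≤ ENNReal.ofReal z := by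
  rw [density_eq_lintegral_count]
  refine (lintegral_count_le_activity_mul_volume h hz hβ measurableSet_unitCube
    (show Bornology.IsBounded (unitCube d) from
      Literature.MathematicalPhysics.StatisticalMechanics.isBounded_unitCube)).trans_eq ?_
  rw [show volume (unitCube d) = 1 from Literature.MathematicalPhysics.StatisticalMechanics.volume_unitCube, mul_one]

/-- **GNZ lower bound `z ≤ ρ + n^d z ρ`**: for a translation-invariant hard-sphere Gibbs state of diameter `ε` with
`2ε ≤ n`, activity `z ≥ 0` and `β > 0`, in positive dimension, `z ≤ ρ (1 + n^d z)` (`ρ` the density): the one-point GNZ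
inequality `ρ ≥ z · P(B(0, ε) vacant)` with `P(vacant) ≥ 1 - E[#B(0, ε)] ≥ 1 - n^d ρ`. [cite: Dereudre2019, Thm 2 and Prop. 10] -/
theorem activity_le_density_add [Nonempty d] {ε z β : ℝ} {u : 𝔼} {μ : Measure (PointConfig (𝔼 × 𝔼))}
    (h : IsHardSphereGibbs ε z β u μ) (hTI : IsTranslationInvariant μ) (hz : 0 ≤ z) (hβ : 0 < β) {n : ℕ}
    (hn : 2 * ε ≤ n) :
    ENNReal.ofReal z ≤ density μ + ENNReal.ofReal z * (((n ^ Fintype.card d : ℕ) : ℝ≥0∞) * density μ) := by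
  haveI := h.1
  have hmain := activity_mul_volume_le_of_isHardSphereGibbs h hz hβ measurableSet_unitCube
    (show Bornology.IsBounded (unitCube d) from Literature.MathematicalPhysics.StatisticalMechanics.isBounded_unitCube)
  rw [show volume (unitCube d) = 1 from Literature.MathematicalPhysics.StatisticalMechanics.volume_unitCube, mul_one,
    ← density_eq_lintegral_count] at hmain
  refine hmain.trans (add_le_add le_rfl (mul_le_mul' le_rfl ?_))
  calc ∫⁻ q in unitCube d, ∫⁻ X, ((X.count (Metric.ball q ε ×ˢ (univ : Set 𝔼)) : ℕ∞) : ℝ≥0∞) ∂μ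
      ≤ ∫⁻ _ in unitCube d, ((n ^ Fintype.card d : ℕ) : ℝ≥0∞) * density μ :=
        lintegral_mono fun q => lintegral_count_ball_le_density hTI q hn
    _ = ((n ^ Fintype.card d : ℕ) : ℝ≥0∞) * density μ := by
        rw [setLIntegral_const, show volume (unitCube d) = 1 from
          Literature.MathematicalPhysics.StatisticalMechanics.volume_unitCube, mul_one]

/-- **The activity–density sandwich in real numbers** (any dimension `d ≥ 1`, any diameter): if the density of a
translation-invariant hard-sphere Gibbs state of diameter `ε`, activity `z ≥ 0`, `β > 0` is `ρ`, and `2ε ≤ n`, then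
`z (1 - n^d ρ) ≤ ρ ≤ z`. [cite: Dereudre2019, Thm 2 and Prop. 10] -/
theorem activity_density_sandwich [Nonempty d] {ε z β : ℝ} {u : 𝔼} {μ : Measure (PointConfig (𝔼 × 𝔼))}
    (h : IsHardSphereGibbs ε z β u μ) (hTI : IsTranslationInvariant μ) (hz : 0 ≤ z) (hβ : 0 < β) {n : ℕ}
    (hn : 2 * ε ≤ n) {ρ : ℝ} (hρ : density μ = ENNReal.ofReal ρ) (hρ0 : 0 ≤ ρ) :
    z * (1 - (n ^ Fintype.card d : ℕ) * ρ) ≤ ρ ∧ ρ ≤ z := by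
  have hU := density_le_activity h hz hβ
  have hL := activity_le_density_add h hTI hz hβ hn
  rw [hρ] at hU hL
  refine ⟨?_, (ENNReal.ofReal_le_ofReal_iff hz).1 hU⟩
  rw [← ENNReal.ofReal_natCast, ← ENNReal.ofReal_mul (Nat.cast_nonneg _), ← ENNReal.ofReal_mul hz,
    ← ENNReal.ofReal_add hρ0 (by positivity), ENNReal.ofReal_le_ofReal_iff (by positivity)] at hL
  nlinarith

/-- **Activity bound for dilute states**: a translation-invariant hard-sphere Gibbs state (diameter `ε`, `2ε ≤ n`,
`β > 0`, activity `z ≥ 0`, dimension `d ≥ 1`) of density `ρ ≤ 1/(2 n^d)` has activity `z ≤ 2ρ` — small density forces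
small activity. [cite: Dereudre2019, Thm 2 and Prop. 10] -/
theorem activity_le_two_mul_density [Nonempty d] {ε z β : ℝ} {u : 𝔼} {μ : Measure (PointConfig (𝔼 × 𝔼))}
    (h : IsHardSphereGibbs ε z β u μ) (hTI : IsTranslationInvariant μ) (hz : 0 ≤ z) (hβ : 0 < β) {n : ℕ}
    (hn : 2 * ε ≤ n) {ρ : ℝ} (hρ : density μ = ENNReal.ofReal ρ) (hρ0 : 0 ≤ ρ)
    (hρ1 : ((n ^ Fintype.card d : ℕ) : ℝ) * ρ ≤ 1 / 2) : z ≤ 2 * ρ := by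
  obtain ⟨h1, -⟩ := activity_density_sandwich h hTI hz hβ hn hρ hρ0
  nlinarith

/-- **Small equal densities force equal small activities up to the density resolution** (the part of
`HardSphereGibbsLowDensityUniqueness` that needs no cluster expansion): two translation-invariant hard-sphere Gibbs
states with activities `z, z'`, the same `β > 0`, and the same density `ρ` with `n^d ρ ≤ 1/2` (`2ε ≤ n`) have both
activities in `[ρ, 2ρ]`, hence `|z - z'| ≤ ρ`. [cite: Dereudre2019, Thm 2 and Prop. 10] -/
theorem abs_activity_sub_le_density [Nonempty d] {ε z z' β : ℝ} {u : 𝔼} {μ μ' : Measure (PointConfig (𝔼 × 𝔼))}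
    (h : IsHardSphereGibbs ε z β u μ) (h' : IsHardSphereGibbs ε z' β u μ') (hTI : IsTranslationInvariant μ)
    (hTI' : IsTranslationInvariant μ') (hz : 0 ≤ z) (hz' : 0 ≤ z') (hβ : 0 < β) {n : ℕ} (hn : 2 * ε ≤ n) {ρ : ℝ}
    (hρ : density μ = ENNReal.ofReal ρ) (hρ' : density μ' = ENNReal.ofReal ρ) (hρ0 : 0 ≤ ρ)
    (hρ1 : ((n ^ Fintype.card d : ℕ) : ℝ) * ρ ≤ 1 / 2) : |z - z'| ≤ ρ := by
  obtain ⟨-, h2⟩ := activity_density_sandwich h hTI hz hβ hn hρ hρ0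
  obtain ⟨-, h2'⟩ := activity_density_sandwich h' hTI' hz' hβ hn hρ' hρ0
  have h3 := activity_le_two_mul_density h hTI hz hβ hn hρ hρ0 hρ1
  have h3' := activity_le_two_mul_density h' hTI' hz' hβ hn hρ' hρ0 hρ1
  rw [abs_sub_le_iff]
  constructor <;> linarith

end Sandwich

end HardSphereDLR

end Literature.MathematicalPhysics.KineticTheory

end
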